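import Summits.SmoothPoincare4.SmoothPoincare4.Theses.CongruenceShadows
import Literature.Topology.FourManifolds.TrisectionFunctorSPC4Proofs
import Literature.Topology.FourManifolds.TrisectionsProofs
import Literature.Topology.FourManifolds.TrisectionsBalancing
import Literature.Topology.FourManifolds.GroupTrisectionsConnectSum
import Literature.Topology.FourManifolds.SPC4HandlesTwoHandlebodyGenusCount
import Literature.AlgebraicTopology.FundamentalGroup.InclHomTransport
import Literature.Topology.FourManifolds.StandardTrisectionSlotSymmetry

/-!
# Disproof of `AgkCor6Sufficiency` (stmt-SmoothPoincare4-10894) — standing disprover's work file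

Crux (shared by routes `GroupTrisection` and `CongruenceShadows`, identical bodies):
`AgkCor6Sufficiency := X → SmoothPoincare4` **by `rfl`** (`agkCor6Sufficiency_iff`), where
`X := ∀ k (K : TrisectionKernels (3k)), IsGroupTrisection (3k) k PUnit K → K.IsStablyTrivial` is
Abrams–Gay–Kirby's Cor. 6 condition (`AgkHypothesis`).  Everything below is PROVED (rc 0, no
`sorry`, axioms `propext / Classical.choice / Quot.sound`); prose only in docstrings.

## Findings (cycle 1, 2026-08-16)

* **No kill, and why it resists.**  `¬ crux ↔ (X ∧ ¬ SmoothPoincare4)` (`not_agkCor6Sufficiency_iff`):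
  a refutation must exhibit an exotic 4-sphere in Lean *and* prove AGK's condition `X`; by AGK
  Cor. 6 (⇒ half) `X` itself follows from SPC4, so on paper `¬crux ↔ False ∧ …` unless Gay–Kirby /
  Abrams–Gay–Kirby are wrong.  The crux is the ⇐ half of a published theorem (AGK 2018 Cor. 6,
  p. 1541: GK Thm. 4 existence + Euler characteristic `g = 3k` + van Kampen + AGK Thm. 5 rigidity
  + stabilisation compatibility), none of which needs Perelman.  Its only attack surface is the
  VENDORING of the pure group theory (`GroupTrisections.lean`), audited here symbol by symbol:
  `SurfaceGroup g = ⟨aᵢ,bᵢ ∣ ∏[aᵢ,bᵢ]⟩`; kernel form of AGK Def. 1 (normal `Kᵢ`, `S/Kᵢ ≅ F_g`,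
  `S/⟪Kᵢ∪Kⱼ⟫ ≅ F_k`, `S/⟪∪Kᵢ⟫ ≅ G`) — faithful because every epimorphism `S_g ↠ F_g` is
  geometric; `Iso` = conjugation by ALL of `Aut S_g` (= `Mod±(Σ_g)` by Dehn–Nielsen–Baer, harmless:
  `S⁴ ≅ -S⁴`); `stabilize` = slot-wise free product with `s4Kernels` (`stabQuotientEquivCoprod`,
  AGK Def. 2–3); `IsStablyTrivial` carries the genus bookkeeping `3 + 3m = g + 3n` by `cast`.
  No junk operator (no ℕ-subtraction/division, no `sSup`, no default values).  Verdict: faithful;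
  `X` is (on paper) EQUIVALENT to SPC4, so the crux is true, SPC4-hard to USE but not to PROVE.
* **§1 Load-bearing analysis.**  The crux has ONE hypothesis, `X`.  `AgkCor6SufficiencyWithoutHyp`
  (drop it) `= SmoothPoincare4` by `rfl`: no `_false_without_X` theorem exists short of an exotic
  `S⁴`; every WEAKENING of `X` (bounded `k`, extra side conditions) keeps the conclusion `SPC4` and
  is equally unrefutable.  So the refutable objects are the natural STRENGTHENINGS of `X` (§5–6)
  and the TIGHTNESS of its numerics (§3).
* **§2 Bookkeeping** (reusable by provers): `isGroupTrisection_stabilizeIter` (type `(g+3n, k+n)`),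
  `isGroupTrisection_cast`, `isGroupTrisection_s4Kernels_stabilizeIter` (`(3+3m, 1+m)` of `{1}`),
  `Iso.nonempty_pairQuotient_equiv`, `Iso.nonempty_tripleQuotient_equiv` (an `Iso` induces isos of
  all vertex groups), `IsFreeOfRank.rank_unique` (Mathlib `Equiv.ofFreeGroupEquiv`).
* **§3 TIGHTNESS `isStablyTrivial_tight`:** a stably trivial `(g,k)` group trisection of `G` has
  `g = 3k` and `G ≅ 1` — the family `(3k, k, {1})` of `X` is exactly where stable triviality can
  hold (`χ = 2 + g - 3k` and `π₁` are stabilisation invariants).  §4: the domain of `X` is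
  inhabited at every `k` by a stably trivial triple (`agkHypothesis_domain_inhabited`), so `X` is
  neither vacuous nor refutable by the standard family.
* **§5 Refuted strengthening I `not_agkHypothesisUnbalanced`:** drop `g = 3k` ⇒ FALSE: the genus-one
  `(1,0)` trisection of `ℂP²` (`⟪a⟫, ⟪b⟫, ⟪ab⟫`, `cp2Kernels_isGroupTrisection`) is a group
  trisection of `{1}` that is not stably trivial (`not_isStablyTrivial_cp2Kernels`).
* **§6 Refuted strengthening II `not_agkHypothesisAnyGroup`:** keep `(3k,k)` but allow any group ⇒
  FALSE: the `(3,1)` trisection of `S¹×S³ # ℂP² # ℂP²` (`zKernels`: handle 0 `(a,a,a)`, handles 1–2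
  `(a,b,ab)`; `zKernels_isGroupTrisection`, group `ℤ` detected by `b₀ ↦ 1 ∈ ℤ/2`) is not stably
  trivial.  So `χ = 2` alone does not give stable triviality; `X` genuinely uses `π₁ = 1`.
* **§7 Downward closure `agkCondition_downward` / `agkCor6Sufficiency_iff_frequently`:** AGK's
  condition at `k₀` implies it at every `k ≤ k₀` (stabilise `k₀ - k` times; `stabilizeIter_add`,
  `isStablyTrivial_of_stabilizeIter`), so the crux is EQUIVALENT to its version with the eventual
  hypothesis "`X` at infinitely many `k`" — provers may assume `X` only for `k ≥ k₀` of their choice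
  (e.g. the Dunfield–Thurston regime `g ≫ |Q|`); conversely no refutation can come from small `k` alone.
* **Targets:** none yet (payload `stuck_stubs = []`); on re-arm the lead's stuck stubs go to a
  `-- Targets` section below §6.
* **Near-misses:** none stated with `sorry`.  NOT attempted on purpose: (i) `¬X` / `¬SPC4` (would be
  an exotic sphere); (ii) the unstable strengthening "every `(3k,k)` trisection of `{1}` is `Iso` to
  the standard one of its genus" (= 4-dimensional Waldhausen / MSZ, open, no small model: the
  first open type is `(3;1,1,1)`); (iii) refuting the three open GK/AGK leaves behind the in-tree
  proof (`exists_isBalancedGKTrisection`, `diffeomorph_of_iso_groupGKTrisectionOf`,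
  `exists_stabilized_gkTrisection` over `IsBalancedGKTrisection`): a junk inhabitant breaking
  rigidity would need a Lean proof that two closed 4-manifolds are NOT diffeomorphic (no invariant
  available in the tree), and the corrected predicate is inhabited (`sphere_genusZero_gkTrisection_holds`),
  so the first vendoring's unsatisfiability attack does not repeat.

## Findings (cycle 2, 2026-08-16, gen-2 seat) — §8–§10 below, all proved (rc 0, std axioms)

* **SPC4 side read back** (Mathlib `ContinuousMap.HomotopyEquiv.NonemptyDiffeomorphSphere M 4` =
  `∀ (_ : ChartedSpace ℝ⁴ M) (_ : IsManifold (𝓡 4) ∞ M), M ≃ₕ 𝕊⁴ → Nonempty (M ≃ₘ 𝕊⁴)`, closed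
  over Hausdorff second-countable `M : Type`): no junk — `M ≃ₕ 𝕊⁴` excludes `∅`, compactness and
  `∂ = ∅` follow; so `¬ crux ↔ X ∧ ∃ exotic S⁴` literally (`not_agkCor6Sufficiency_iff_exotic`).
* **§8 Anatomy of a disproof through the tree.**  The crux is PROVED in tree from three leaves
  (`spc4_of_forall_isStablyTrivial_of_three_leaves`); GK Thm. 4 is DISCHARGED
  (`exists_isBalancedGKTrisection_holds`, axioms checked here: propext/choice/Quot.sound), so
  `¬ crux → ¬ ((b′) ∧ (c′))` (`not_agkCor6Sufficiency_imp_not_leaves`).  The in-tree proof uses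
  (b′) `diffeomorph_of_iso_groupGKTrisectionOf` ONLY against the round sphere and ONLY for
  homotopy 4-spheres: that LOAD-BEARING INSTANCE `RigidityVsSphere` follows from (b′) and from the
  summit (`rigidityVsSphere_of_spc4`), and re-running the assembly with it
  (`nonemptyDiffeomorphSphere_of_rigidityVsSphere`) gives, granted (c′),
  `¬ crux ↔ X ∧ ¬ RigidityVsSphere` (`not_agkCor6Sufficiency_iff_of_stabilization`).  So EVERY
  conjunct of a disproof is an exotic `S⁴` in disguise; in particular no junk inhabitant of
  `IsBalancedGKTrisection` can break the leaf instance the crux needs (it would break SPC4).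
* **Leaves (b′), (c′) read back** (TrisectionFunctorGK.lean:221/246 over `IsBalancedGKTrisection`,
  Trisections.lean:678: sectors = topologically embedded compact connected `W` with
  `HasHandleDecomposition 3 W (handleCount 1 k)` — Morse-theoretic: a boundary-adapted Morse
  function with exactly one index-0 and `k` index-1 critical points —, `C^∞`-immersed off `F`,
  corner charts on `F`; double intersections = smoothly embedded genus-`g` 3-d 1-handlebodies `H`
  with `h(∂H) = F`).  Junk probes, all closed on paper: `S i ∩ S j ⊆ e(∂W)` is only `⊆` but
  equality is forced by invariance of domain; `H` non-orientable is excluded because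
  `∂W = H ∪_F H'` is closed orientable (`W ⊆ X` codim 0); markings are arbitrary group isos but
  `Iso` absorbs them (`groupGKTrisectionOf_iso_of_markings`); `Iso` over all of `Aut S_g` vs AGK's
  orientation-preserving isomorphisms is harmless (DNB±, unoriented conclusion); (b′) on paper =
  DNB + "kernel determines the handlebody" (Dehn) + Laudenbach–Poénaru (Cerf `Γ₄ = 0` at genus 0),
  no Perelman; `s4Kernels = (⟪a₁,a₂,b₃⟫, ⟪a₁,b₂,a₃⟫, ⟪b₁,a₂,a₃⟫)` IS the geometric genus-3 `S⁴`
  triple (handle patterns `(a,a,b),(a,b,a),(b,a,a)`), and `stabilize` = kernel of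
  `S_{g+3} ↠ (S_g/K) ∗ (S_3/K')` including the separating curve `r_g` (it bounds the summing disc),
  matching GK's connected sum of trisections.  Verdict: faithful; even a wrong-but-(3,1) choice of
  `s4Kernels` would leave `X ⇔ SPC4` on paper (all homotopy spheres mutually diffeomorphic ⇒ all `S⁴`).
* **§9 No finite truncation of `X` is usable**: `AgkCor6SufficiencyUpTo k₀ := X_{≤k₀} → SPC4` is
  stronger than the crux, monotone in `k₀`, and AT `k₀ = 0` IT IS THE SUMMIT
  (`agkCor6SufficiencyUpTo_zero_iff`, since `X_0` is a theorem, `agkCondition_zero`); `X_1` ("every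
  genus-3-trisected homotopy 4-sphere is stably `S⁴`") is open in print — `(3;1,1,1)` is the first
  type outside Meier–Schirmer–Zupan's classification.
* **§10 Witness normal form**: in a witness of `IsStablyTrivial` the standard side is FORCED,
  `k + n = 1 + m` (`eq_of_isStablyTrivial_witness`), whence the one-existential form
  `isStablyTrivial_iff_exists(_balanced)` (route CongruenceShadows consumes `n = 0, m = k - 1`).
  TREE GAP for provers: `Iso K K' → Iso K.stabilize K'.stabilize` exists only for LIFTABLE
  automorphisms (`TrisectionKernels.Iso.stabilize_of_lift`, TrisectionFunctorGKStabilization.lean),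
  i.e. modulo Nielsen's lifting theorem; so "stably trivial is Iso-invariant / upward stable" is
  not yet in tree for `n = 0` witnesses (`isStablyTrivial_stabilize_of_witness` covers `n ≥ 1`).
* **Why it still resists (cycle 2 summary).**  `¬ crux` = `X ∧ exotic S⁴`; `X` is SPC4-equivalent
  on paper (AGK Cor. 6) and inhabited-but-unrefutable in every constructed family (§4–§7); the only
  open leaves on the proof path are published theorems whose load-bearing instances are themselves
  consequences of SPC4 (§8).  Remaining surfaces are FORMALISATION risks for provers, not falsity:
  Nielsen lifting (above), DNB±, kernel-determines-handlebody, LP/Cerf — tracked by the crux lines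
  (Ideas/, TRIAGE-r1-*).  Targets: none yet (no line picked); stub kills go to `-- Targets` on re-arm.

## Findings (cycle 3, 2026-08-16, gen-3 seat) — §11–§12 below: the REGISTERED SKELETON's stubs

Targets = the seven stubs of `Lines/level-set-kirby-triple.lean` (skeleton sha `ea27592aaaf5`,
registered 02:33Z; PICKED by the line lead at 02:39Z, `PICKED.md`) + the two sibling lines (the
lead's fallbacks).  The skeleton module has no `.olean`, so its stub STATEMENTS are re-declared
verbatim in the sub-namespace `…Disproof.LevelSetKirbyTriple` (§11.2) and the facts below are
ABOUT those copies.  VERDICT: no stub is false — all seven are true on paper and faithfully typed;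
the adversary's yield this cycle is four kernel-checked COST / DESIGN facts the lead should price
in.  CONCORDANCE with the parallel drefute seat (`DrefuteLevelSetKirbyTriple.md`,
`DrefuteStubLevelStabilizeOne.md`, same directory; landed `…/Negative/LevelStabilizeOneRemarking.lean`,
`…/Negative/StabilizeOneLift.lean`): identical verdicts on all seven stubs, reached independently;
its (S) analysis is the general form of §11.4 (`S = S₀ + N₁`, `N₁` = the tree's Nielsen hypothesis
`hN`, with the converse `hN + S₀ ⟹ S` kernel-checked there) — read both.

* **(E₀) `LevelDatumExists`** — survives.  No orientation hypothesis, deliberately harmless: the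
  tree's `exists_isGKTrisection` (TrisectionsExistenceUnbalanced.lean:450) is orientation-free
  too, because clauses (ii)/(iii) of `IsGKTrisection` ask for `HasHandleDecomposition` only (no
  orientability of sectors / handlebodies), so non-orientable `M` get non-orientable pieces.
  `ncard` fields sit on finite critical sets (compact `M`, Morse `f`): no junk `0`.  The tree's
  construction has type `![k₁, g - m, k₁]` with `#index 3 = #index 1`
  (`exists_isMorse_apply_eq_three_mul_index`), matching `ncard_top_three = κ 2`.
* **(S) `LevelStabilizeOne`** — survives, slot convention checked (`unbalancedKernels i`: slot `i`
  is `⟪b⟫` ↔ `Function.update κ i`, = (1,2)-birth / Heegaard stabilisation / (2,3)-birth for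
  `i = 0, 1, 2` under `κ = (#1-h, g − #2-h, #3-h)`).  **COST (kernel-checked, §11.4):** its shape
  `∃ d', ∀ markings, Iso …` makes (S) CONTAIN the `Iso`-invariance of `stabilizeOne` on realised
  triples (`iso_stabilizeOne_of_levelStabilizeOne`, `…_of_iso_…`, `…_twist_…`: for every
  automorphism `α` of `S_g`, `(α • K).stabilizeOne i ≅ K.stabilizeOne i`) — the algebraic
  shadow of Dehn–Nielsen–Baer / Nielsen–Zieschang lifting, i.e. the §10 tree gap.  So the line
  does NOT avoid Nielsen lifting as its docstring claims; it moved into (S) (the tree's on-the-nose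
  theorem `exists_marking_groupGKTrisectionOf_eq_stabilizeOne_datum` needs the marking to factor
  through a free basis `θA` of `π₁(F ∖ D)` with `θA(r_g) = t`, which an arbitrary — e.g.
  orientation-reversing — marking does not a priori do).  The drefute seat's corrected signature
  (A) `stub_levelStabilizeOne : SurfaceGroupNielsenLifting → LevelStabilizeOne` (the tree's `hN`
  verbatim, shared with fact (c′)) is endorsed here.
* **(DNB) `DehnNielsenBaerGK`** — true on paper (based DNB±: `Homeo(Σ_g, x₀) ↠ Aut π₁`, Birman
  sequence; `g = 0, 1` direct), but **DESIGN GAP**: it concludes with a HOMEOMORPHISM `≃ₜ` of the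
  central-surface subtypes, while its only consumer (R1) must feed (HKE), which takes a
  DIFFEOMORPHISM `b.carrier ≃ₘ⟮𝓡 2, 𝓡 2⟯ b'.carrier` of abstract boundary carriers — the bridge is
  "surface homeomorphisms are isotopic to diffeomorphisms" (Munkres 1960 / Epstein 1966), absent
  from the tree.  The sibling lines already chose smooth forms (`DehnNielsenBaerCentral` with
  `AmbientSmooth`; `DehnNielsenBaer` on `b.carrier`, smooth).  Recommended re-typing: conclude with
  a diffeomorphism between the boundary data of the clause-(iii) handlebodies
  (`IsGKTrisection.exists_isHandlebody`, PROVED) inducing `μ' ∘ α ∘ μ⁻¹`.  Not a falsity (R1 is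
  true outright, so `LP → DNB → HKE → R1` holds), but as typed (DNB) cannot carry its load.
* **(HKE) `HandlebodyKernelExtension`** — faithful (`IsHandlebody` = compact ∧ connected ∧
  orientable ∧ `(1, g)` handles; `BoundaryData` = the whole boundary), true on paper (meridian
  discs, Alexander, `Γ₃ = 0` = the tree's proved `extendsOverBall_two`).  **Sharp (kernel-checked,
  §11.1):** the kernel condition is NECESSARY (`map_ker_eq_ker_of_semiconj`, pure topology;
  `extends_iff_kernel`) — (HKE) and the sibling `HandlebodyExtension` are `iff`s.
* **(LP) `exists_diffeomorph_comp_incl_eq`** — tree named fact; genus `0` is Cerf `Γ₄ = 0`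
  (`cerf_…_of_exists_diffeomorph_comp_incl_eq`); no junk inhabitant (a closed `V` admits no
  Morse-adapted `f` with all indices `≤ 1`).
* **(R1) `TwoHandlebodyRecognition` (hardest)** — true on paper: `{f ≤ c} = X₁ ∪ X₂ ∪ (closure S₃
  ∩ {f ≤ c})`, the last piece a relative collar `H₃₁ × I` attached along `H₃₁ ∪ F × I`
  (`TrisectionsMiddleSectors`: `X₃ = closure S₃ ∪ {f ≥ c}`, `S₃ = {¬X₁, Hit, M > 0}`), so
  `{f ≤ c} ≅ X₁ ∪ X₂` smoothed, and AGK Thm 5 rigidity-with-structure carries `X₁ ∪ X₂` to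
  `X₁' ∪ X₂'`.  (Drefute caveat, endorsed: `{f ≥ c} ⊄ int X₃` — it meets `X₂` along
  `f⁻¹(c) ∩ {G ≤ -ε}` —, and `LevelDatum` does not forbid critical points of index `≤ 2` inside
  `closure S₃ ∩ (a, c)` except through `isGKTrisection`; R1's flow-straightening wants "no critical
  point in the collar piece", derivable or cheaply added as a field now.)  **COST:** any proof of (R1) in the stated generality is two thirds of (b′) (spine
  neighbourhood from DNB + HKE + corner model, two of the three LP fillings) — the saving over (b′)
  is ONE LP filling, not "the triple corner along `F`" (the spine neighbourhood contains it).
  **Load-bearing instance (kernel-checked, §11.3):** the composition consumes (R1, R2) only as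
  `LevelRigidityVsSphere` (`M ≃ₕ 𝕊⁴` vs `𝕊⁴`), which follows from (R1) ∧ (R2) AND from the summit
  (`levelRigidityVsSphere_of_spc4`); re-running the composition
  (`nonemptyDiffeomorphSphere_of_levelLine`): granted (E₀), (S),
  `¬ crux ↔ X ∧ ¬ LevelRigidityVsSphere` (`not_agkCor6Sufficiency_iff_of_levelLine`).  So no junk
  level datum can refute what the line needs, and DNB/HKE/LP/R1/R2 matter only through an
  SPC4-consequence — the lead may specialise (R1), (R2) to `M' = 𝕊⁴`, `M` a homotopy sphere.
* **(R2) `TwoHandlebodyReassembly`** — true on paper (`{f ≥ c}` upside down = one `0`-handle +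
  `κ 2` `1`-handles ⇒ `♮^{κ 2} S¹ × B³`, connected, orientable; then the tree's
  `nonempty_diffeomorph_of_isBoundaryGluing_twoHandlebody` from LP along the `RegularSublevel`
  splitting); "same `(g, κ)`" is decoration beyond `d, d'`.
* **Sibling `lp-by-sphere-system-surgery` (§12):** its lever `FillingUniqueness` is EQUIVALENT to the
  tree's LP fact (`fillingUniqueness_iff_lp`, kernel-checked both ways through the PROVED
  classification `nonempty_diffeomorph_of_isHandlebodyOfIndexLE_one_of_boundary_homeomorph` and
  `BoundaryData.restrictDiffeomorph`): the line is a new PROOF of LP (Meier–Scott 2025), not a new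
  statement; `HandlebodyExtension` is an `iff` by §11.1.
* **Sibling `lp-by-minimal-heegaard-splitting`:** `MinimalHeegaardIsotopy` read faithfully (`Y ≅ ∂V`,
  `V` a `(1, k)`-handlebody ⇒ `Y ≅ #ᵏ S¹ × S²`; two genus-`k` splittings ⇒ `Φ` diffeotopic to `id`
  carrying one to the other up to a side swap); on paper = Carvalho–Oertel 2005 / Moussard 2024
  Thm 2.1 (search-degraded this cycle: `lit` rc 75, isotopy claim not re-read in print; `k = 0`
  disc theorem, `k = 1` Gluck's generators preserve `S¹ × equator`).  Its `DehnNielsenBaer` is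
  the SELF-map form on `∂H`; the consumer `stub_rigidity_of_lp` needs maps between TWO central
  surfaces: bridge = `IsGKTrisection.exists_isHandlebody` (PROVED) + UNIQ₃
  `IsHandlebody.nonempty_diffeomorph` (named fact, reduced in tree to L1
  `oneHandle_nonempty_diffeomorph`) + `restrictDiffeomorph` — a "Leans on" absent from the card.
* **Why it still resists (cycle 3).**  Unchanged: `¬ crux ↔ X ∧ exotic S⁴`; every stub of every
  line is a true theorem whose load-bearing instance is SPC4-implied or independent classical
  (DNB, HKE, LP).  No `_false` target exists; the deliverables are cost certificates.

## Findings (cycle 4, 2026-08-16, gen-4 seat) — §13 below, all proved (rc 0, std axioms)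

* **State.**  (E₀) `stub_levelDatum_exists` is LANDED by the line lead
  (`Theorems/CongruenceShadowsAgkCor6SufficiencyStubLevelDatumExists.lean`, p78420: the
  `exists_isGKTrisection` pipeline re-run with its data kept); skeleton sha unchanged; no stuck
  stubs handed over.  Literature sweep this cycle was search-degraded (searchd down, OpenAlex /
  S2 / arXiv 429; crossref only: nothing negative on AGK Cor. 6 — Klug 2018 "Functoriality of
  group trisections", Kirby–Thompson 2021, Lambert-Cole 2020 are consumers, not counterexamples).
* **§13.1 Stabilisation remembers the triple (new algebra, reusable).**  The retraction
  `ρ : S_{g+3} ↠ S_g` killing the new handles satisfies `ρ (K.stabilize i) = K i`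
  (`map_stabRetract_stabilize`), so `stabilize` / `stabilizeIter n` are INJECTIVE on triples of
  normal subgroups (`stabilize_injective`, `eq_of_stabilizeIter_eq`).  **Refuted strengthening
  III `not_agkHypothesisNose`:** `X` with `Iso` replaced by equality ("stably standard ON THE
  NOSE") is false at `k = 1` — the slot-cycled standard triple `cycKernels = (N₂, N₀, N₁)` is a
  `(3,1)` group trisection of `{1}`, `Iso` to `s4Kernels` by the tree's relator-fixing handle
  shift `cyc` (so stably trivial with `n = m = 0`), yet no stabilisation of it equals a standard
  triple (`ρⁿ` would give `N₂ = N₀ ∌ a₀`).  So the re-marking automorphism inside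
  `IsStablyTrivial` is load-bearing: `X` can neither be supplied nor consumed on the nose, and
  the only question is whether an `Iso` must ever be pushed THROUGH a stabilisation (Nielsen).
* **§13.2 It need not be: the hidden Nielsen hypothesis N₁ of stub (S) is NOT load-bearing for
  the line.**  Kernel-checked `X`-once composition `nonemptyDiffeomorphSphere_of_levelLine_nose`
  from (E₀), two N₁-free WEAKENINGS of (S) — (Sₓ) `LevelStabilizeOneExists` (one-slot, type only,
  for balancing) and (S_nose) `LevelRoundsNose` (full rounds on the nose for ONE marking, the
  geometric one) —, (Z₀) `SphereLevelDatumZero` (a `(0;0,0,0)` level datum on the round `S⁴`),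
  `LevelRigidityVsSphere` and `X`: apply `X` once to the distinguished marking of `M`'s balanced
  datum, realise `stabilizeIter n` by the tower, and meet the level `m` dictated by `X` EXACTLY on
  the `S⁴` side, where the genus-`0` tower is standard on the nose at every level
  (`trivialKernels_stabilizeIter_succ`; `TrisectionKernels 0` is a subsingleton, so markings of
  the genus-`0` datum are irrelevant).  (S) ⟹ (Sₓ) ∧ (S_nose) (`levelStabilizeOneExists_of_…`,
  `levelRoundsNose_of_…`), hence the trade is exactly **Nielsen lifting (L–XL new algebra) ↔ (Z₀)
  (one explicit instantiation of the E₀ pipeline on `𝕊⁴ ⊃ 𝕊³ ⊃ 𝕊²` with hand-made genus-`0`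
  Heegaard data of the equator; size L, no new theory)**, and granted (E₀), (Sₓ), (S_nose), (Z₀):
  `¬ crux ↔ X ∧ ¬ LevelRigidityVsSphere` (`not_agkCor6Sufficiency_iff_of_noseLine`).  This
  CORRECTS the cycle-3 / drefute reading "the composition cannot dodge N₁": it cannot in the
  registered architecture (X twice, `S⁴` identified with the standard triple abstractly and then
  stabilised further), it can with (Z₀).  NUANCE (paper): the instances of N₁ the registered
  composition needs are also derivable from the line's OWN stub (DNB) — which (R1) needs for
  arbitrary `α ∈ Aut S_g` anyway —: realise `α` by a based homeomorphism `ψ` of the central surface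
  (DNB±), isotope `ψ` rel `x₀` to be `± id` on a disc `D ∋ x₀` (local Alexander trick), and read
  `ψ_*` on `π₁(F ∖ D)` through the geometric free basis `θ_D` of the tree's stabilisation datum:
  this is a free lift `φ` of `α` with `φ(r_g)` conjugate to `r_g^{±1}`, i.e. the tree's `hN` at
  `α`, whence N₁ by `StabilizeOneLift.iso_stabilizeOne_map_of_nielsen`.  So Nielsen's theorem as
  free-standing combinatorial group theory is NEVER required by this line; the lead's real choice
  is (i) the `X`-once architecture with (Z₀) and no N₁ at all, or (ii) `X` twice with N₁
  discharged from (DNB) + a disc-fixing isotopy lemma (M) + `θ_D` transport.  Recommendation (a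
  reshape is the lead's call): (i) if (Z₀) is judged cheaper than the isotopy lemma, else (ii);
  in both cases register (S) split as (Sₓ) + (S_nose) [+ N₁ as an explicit stub in case (ii)].
* **(R1) junk caveat, sharpened (paper).**  The local clauses of `IsGKTrisection` (sectors =
  images of boundary-manifolds `W`, immersed off `F`) exclude every junk critical point of `f` in
  the collar piece `C = X₃ ∩ {f ≤ c}` EXCEPT configurations whose dividing interface is smooth
  through the critical point — e.g. an index-`1` point in `(a, c)` whose two descending arcs land
  on opposite sides of `F` (then `X₂`/`X₃` are the two half-spaces of its `3`-dimensional unstable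
  sheet, angle `π`, no corner) together with its cancelling index-`2` partner whose descending
  disc lands on an arc crossing `F` with exactly balanced sides.  Whether such a datum exists
  globally with `H₂₃` still a genus-`g` handlebody is unclear; none changes `{f ≤ c}` (births below
  `c` preserve the sublevel set), so no counterexample to (R1) results, but R1's flow-straightening
  of `C` should not rely on "no critical point in `C`" without adding it as a `LevelDatum` field
  (it holds for E₀'s data: critical values `3 · index`, `c = 6 + η/4`).
* **Why it still resists (cycle 4).**  Unchanged: `¬ crux ↔ X ∧ exotic S⁴`; three refuted
  strengthenings of `X` (unbalanced, any group, on the nose) bracket it tightly, every weakening is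
  the summit, and along the picked line every conjunct of a disproof is `¬ LevelRigidityVsSphere`,
  an exotic `S⁴` in disguise — now even without the Nielsen hypothesis.

Negative lemmas filed from this file (`--kind proof --supports stmt-SmoothPoincare4-10894`):
`Theorems/AgkCor6Sufficiency/Negative/StablyTrivialTight.lean` (§2–§4b; reusing
`WaldhausenPairs/Negative/LoadBearing.lean`'s `IsFreeOfRank.rank_eq` / `stabilizeIter_isGroupTrisection` and
`SphereTrisections.lean`'s `trivialKernels_stabilize`), `…/Negative/UnbalancedFalse.lean` (§5),
`…/Negative/AnyGroupFalse.lean` (§6), `…/Negative/DownwardClosed.lean` (§7); cycle 2: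
`…/Negative/LoadBearingRigidity.lean` (§8, load-bearing rigidity inlined, no `Prop` constants),
`…/Negative/WitnessNormalForm.lean` (§9–§10).  This work file keeps self-contained copies so that it
elaborates on its own (cycle 2 adds the imports `TrisectionFunctorSPC4Proofs`, `TrisectionsProofs`;
cycle 3 adds `TrisectionsBalancing`, `GroupTrisectionsConnectSum`, `SPC4HandlesTwoHandlebodyGenusCount`,
`Literature.AlgebraicTopology.FundamentalGroup.InclHomTransport`).  Cycle 3 files LANDED:
`…/Negative/KernelNecessity.lean` (§11.1, p77312), `…/Negative/FillingUniquenessIffLP.lean` (§12, p77833);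
§11.2–§11.4 stay in this work file (they need the `LevelDatum` copy), the (S) part being landed in
general, datum-free form by the drefute seat (`…/Negative/LevelStabilizeOneRemarking.lean`,
`…/Negative/StabilizeOneLift.lean`); a separate `StabilizeOneIsoInvariance.lean` (p78924, bounced only by a
gate restart) was NOT resubmitted, being redundant with those.  Cycle 4 adds the import
`StandardTrisectionSlotSymmetry` (for `cyc`) and files `…/Negative/StabilizeRetract.lean` (§13.1, p83251) and
`…/Negative/NoseLine.lean` (§13.2 stated GENERICALLY over any datum family `D M g κ` with sector map
`sec` and `hsec : IsGKTrisection M g κ (sec d)` — the E₀ module having no `.olean` on the farm yet —;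
the line is the instance `D := LevelDatum`, `sec d := d.T.sectors`, `hsec d := d.isGKTrisection`,
under which `groupGKTrisectionOf (hsec d)` is `d.kernels` by `rfl`).
-/

set_option linter.dupNamespace false

namespace Summit.SmoothPoincare4.SmoothPoincare4.Cruxes.AgkCor6Sufficiency.Disproof

open Literature.Topology.FourManifolds Subgroup
open Summit.SmoothPoincare4.SmoothPoincare4.Theses.CongruenceShadows (AgkCor6Sufficiency)

/-! ## 0. Shape of the crux -/

/-- AGK's Cor. 6 condition, the single hypothesis `X` of the crux. -/
def AgkHypothesis : Prop :=
  ∀ (k : ℕ) (K : TrisectionKernels (3 * k)),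
    IsGroupTrisection (3 * k) k (PUnit : Type) K → K.IsStablyTrivial

/-- The crux is literally `X → SmoothPoincare4`. -/
theorem agkCor6Sufficiency_iff : AgkCor6Sufficiency ↔ (AgkHypothesis → _root_.SmoothPoincare4) :=
  Iff.rfl

/-- Hence a disproof of the crux is exactly: AGK's hypothesis holds AND an exotic 4-sphere exists. -/
theorem not_agkCor6Sufficiency_iff :
    ¬ AgkCor6Sufficiency ↔ (AgkHypothesis ∧ ¬ _root_.SmoothPoincare4) := by
  rw [agkCor6Sufficiency_iff, Classical.not_imp]

/-- The crux is implied by the summit and by `¬X` (both by one-line logic: `fun _ => h`,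
`fun x => absurd x h`); recorded as a disjunction so that no declaration here concludes the route
decl itself. -/
theorem agkCor6Sufficiency_of_spc4_or_not_agkHypothesis (h : _root_.SmoothPoincare4 ∨ ¬ AgkHypothesis) :
    AgkHypothesis → _root_.SmoothPoincare4 := fun x => h.elim id fun h' => absurd x h'

/-! ## 1. Load-bearing analysis -/

/-- The crux with its only hypothesis dropped. -/
def AgkCor6SufficiencyWithoutHyp : Prop :=
  ∀ (M : Type) [TopologicalSpace M] [T2Space M] [SecondCountableTopology M],
    ContinuousMap.HomotopyEquiv.NonemptyDiffeomorphSphere M 4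

/-- Dropping `X` leaves the summit itself: no `_false_without_` theorem is available short of an
exotic `S⁴`. -/
theorem agkCor6SufficiencyWithoutHyp_eq : AgkCor6SufficiencyWithoutHyp = _root_.SmoothPoincare4 := rfl

/-! ## 2. Bookkeeping lemmas: type of stabilisations, transport, invariance under `Iso` -/

section Bookkeeping

variable {g : ℕ}

/-- Iterated stabilisation of a `(g,k)` trisection of `G` is a `(g+3n, k+n)` trisection of `G`. -/
theorem isGroupTrisection_stabilizeIter {k : ℕ} {G : Type} [Group G] {K : TrisectionKernels g}
    (hK : IsGroupTrisection g k G K) :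
    ∀ n : ℕ, IsGroupTrisection (g + 3 * n) (k + n) G (K.stabilizeIter n)
  | 0 => hK
  | n + 1 => stabilize_isGroupTrisection_holds _ _ G _ (isGroupTrisection_stabilizeIter hK n)

/-- Transport along an equality of genera preserves the trisection property. -/
theorem isGroupTrisection_cast {g' k : ℕ} {G : Type*} [Group G] {K : TrisectionKernels g}
    (hK : IsGroupTrisection g k G K) (h : g = g') : IsGroupTrisection g' k G (K.cast h) := by
  subst h
  exact hK

/-- The standard triples `s4Kernels.stabilizeIter m` are `(3+3m, 1+m)` trisections of `{1}`. -/
theorem isGroupTrisection_s4Kernels_stabilizeIter (m : ℕ) :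
    IsGroupTrisection (3 + 3 * m) (1 + m) (PUnit : Type) (s4Kernels.stabilizeIter m) :=
  isGroupTrisection_stabilizeIter s4Kernels_isGroupTrisection_holds m

/-- An isomorphism of kernel triples induces isomorphisms of the pairwise quotients. -/
theorem Iso.nonempty_pairQuotient_equiv {K K' : TrisectionKernels g} (h : K.Iso K') (i j : Fin 3) :
    Nonempty (K.pairQuotient i j ≃* K'.pairQuotient i j) := by
  obtain ⟨α, hα⟩ := h
  have hs : ∀ l, (⇑α) '' (K l : Set (SurfaceGroup g)) = K' l := fun l => by
    rw [← hα l, coe_map]; rfl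
  refine ⟨QuotientGroup.congr _ _ α ?_⟩
  rw [map_normalClosure _ _ (show Function.Surjective (α : SurfaceGroup g →* SurfaceGroup g) from
    α.surjective), Set.image_union]
  simp only [MonoidHom.coe_coe, hs]

/-- An isomorphism of kernel triples induces an isomorphism of the triple quotients. -/
theorem Iso.nonempty_tripleQuotient_equiv {K K' : TrisectionKernels g} (h : K.Iso K') :
    Nonempty (K.tripleQuotient ≃* K'.tripleQuotient) := by
  obtain ⟨α, hα⟩ := h
  have hs : ∀ l, (⇑α) '' (K l : Set (SurfaceGroup g)) = K' l := fun l => by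
    rw [← hα l, coe_map]; rfl
  refine ⟨QuotientGroup.congr _ _ α ?_⟩
  rw [map_normalClosure _ _ (show Function.Surjective (α : SurfaceGroup g →* SurfaceGroup g) from
    α.surjective), Set.image_iUnion]
  simp only [MonoidHom.coe_coe, hs]

/-- Free groups of different finite ranks are not isomorphic (rank is an invariant). -/
theorem IsFreeOfRank.rank_unique {H : Type*} [Group H] {a b : ℕ} (ha : IsFreeOfRank H a)
    (hb : IsFreeOfRank H b) : a = b := by
  obtain ⟨ea⟩ := ha
  obtain ⟨eb⟩ := hb
  simpa using Fintype.card_congr (Equiv.ofFreeGroupEquiv (ea.trans eb.symm))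

end Bookkeeping

/-! ## 3. Tightness: stable triviality forces AGK's numerics `g = 3k`, `G = 1` -/

/-- **Tightness of the `(3k, k, {1})` family.**  If a `(g,k)` group trisection `K` of `G` is stably
trivial then `g = 3k` and `G` is trivial: the hypothesis family of AGK Cor. 6 is exactly the family
on which stable triviality is possible. -/
theorem isStablyTrivial_tight {g k : ℕ} {G : Type} [Group G] {K : TrisectionKernels g}
    (hK : IsGroupTrisection g k G K) (hst : K.IsStablyTrivial) :
    g = 3 * k ∧ Nonempty (G ≃* PUnit.{1}) := by
  obtain ⟨n, m, h, hiso⟩ := hst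
  have h₁ := isGroupTrisection_stabilizeIter hK n
  have h₂ := isGroupTrisection_cast (isGroupTrisection_s4Kernels_stabilizeIter m) h
  obtain ⟨e⟩ := Iso.nonempty_pairQuotient_equiv hiso 0 1
  have hk : k + n = 1 + m :=
    IsFreeOfRank.rank_unique ((h₁.free_pairQuotient 0 1 (by decide)).of_mulEquiv e)
      (h₂.free_pairQuotient 0 1 (by decide))
  obtain ⟨t⟩ := Iso.nonempty_tripleQuotient_equiv hiso
  obtain ⟨eG⟩ := h₁.triple
  obtain ⟨e1⟩ := h₂.triple
  exact ⟨by omega, ⟨eG.symm.trans (t.trans e1)⟩⟩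


/-! ## 4. Non-vacuity: the domain of `X` is inhabited at every `k`, by stably trivial triples -/

/-- Transport does not change stable triviality. -/
theorem isStablyTrivial_cast_iff {g g' : ℕ} (K : TrisectionKernels g) (h : g = g') :
    (K.cast h).IsStablyTrivial ↔ K.IsStablyTrivial := by
  subst h
  rfl

/-- The standard family is stably trivial with no stabilisation at all. -/
theorem isStablyTrivial_s4Kernels_stabilizeIter (m : ℕ) : (s4Kernels.stabilizeIter m).IsStablyTrivial :=
  ⟨0, m, rfl, TrisectionKernels.Iso.refl _⟩

/-- `genShift 0` is the identity on `F⟨surfaceGen 3⟩` (`Fin.natAdd 0 = id` propositionally). -/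
theorem genShift_zero : genShift 0 = MonoidHom.id (FreeGroup (surfaceGen 3)) := by
  refine FreeGroup.ext_hom _ _ fun p => ?_
  rw [genShift_of, MonoidHom.id_apply]
  congr 1
  refine Prod.ext (Fin.ext ?_) rfl
  simp

/-- `genIncl 0` is trivial (the free group on no generators is trivial). -/
theorem genIncl_zero_apply (w : FreeGroup (surfaceGen 0)) : genIncl 0 w = 1 := by
  rw [Subsingleton.elim w 1, map_one]

/-- **The stabilisation of the `(0,0)` triple is literally the genus-`3` `S⁴` triple.** -/
theorem trivialKernels_stabilize : trivialKernels.stabilize = (s4Kernels : TrisectionKernels 3) := by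
  funext i
  haveI := s4Kernels_isGroupTrisection_holds.normal i
  rw [TrisectionKernels.stabilize_apply]
  apply le_antisymm
  · refine normalClosure_le_normal ?_
    rintro x (⟨w, -, rfl⟩ | ⟨w, hw, rfl⟩)
    · simp only [Function.comp_apply, genIncl_zero_apply, map_one, SetLike.mem_coe]
      exact one_mem _
    · simpa [genShift_zero] using hw
  · intro x hx
    apply subset_normalClosure
    right
    obtain ⟨w, rfl⟩ := PresentedGroup.mk_surjective _ x
    exact ⟨w, hx, by simp [genShift_zero]⟩

/-- The `(0,0)` trisection of the trivial group is stably trivial: one stabilisation gives the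
genus-`3` `S⁴` triple on the nose (`3 + 3·0 = 0 + 3·1` by `rfl`). -/
theorem trivialKernels_isStablyTrivial : trivialKernels.IsStablyTrivial :=
  ⟨1, 0, rfl, by
    show TrisectionKernels.Iso trivialKernels.stabilize s4Kernels
    rw [trivialKernels_stabilize]
    exact TrisectionKernels.Iso.refl _⟩

/-- Every kernel triple of genus `0` is the trivial one (`S_0 = 1`). -/
theorem eq_trivialKernels (K : TrisectionKernels 0) : K = trivialKernels := by
  funext i
  exact Subsingleton.elim _ _


/-- For every `k` there is a `(3k, k)` group trisection of `{1}` which IS stably trivial (the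
`(0,0)` one for `k = 0`, the transported standard `(3+3m, 1+m)` one for `k = m + 1`): the hypothesis
`X` quantifies over an inhabited family and cannot be refuted inside the standard family. -/
theorem agkHypothesis_domain_inhabited (k : ℕ) :
    ∃ K : TrisectionKernels (3 * k), IsGroupTrisection (3 * k) k (PUnit : Type) K ∧ K.IsStablyTrivial := by
  cases k with
  | zero => exact ⟨trivialKernels, GroupTrisection.trivial.isGroupTrisection, trivialKernels_isStablyTrivial⟩
  | succ m =>
    have h := isGroupTrisection_s4Kernels_stabilizeIter m
    rw [Nat.add_comm 1 m] at h
    exact ⟨(s4Kernels.stabilizeIter m).cast (by ring), isGroupTrisection_cast h _,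
      (isStablyTrivial_cast_iff _ _).2 (isStablyTrivial_s4Kernels_stabilizeIter m)⟩

/-! ## 4b. Small-model toolkit for explicit kernel triples -/

section Toolkit

variable {g : ℕ}

/-- A quotient of `S_g` by a normal subgroup containing every generator is trivial. -/
theorem subsingleton_quotient_of_forall_of_mem (N : Subgroup (SurfaceGroup g)) [N.Normal]
    (h : ∀ x : surfaceGen g, (PresentedGroup.of x : SurfaceGroup g) ∈ N) :
    Subsingleton (SurfaceGroup g ⧸ N) := by
  refine ⟨fun x y => ?_⟩
  obtain ⟨x, rfl⟩ := QuotientGroup.mk_surjective x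
  obtain ⟨y, rfl⟩ := QuotientGroup.mk_surjective y
  exact QuotientGroup.eq.2 (PresentedGroup.generated_by _ N h _)

/-- The surface relator dies in every commutative group. -/
theorem lift_surfaceRelator_eq_one_of_comm {C : Type*} [CommGroup C] (f : surfaceGen g → C) :
    FreeGroup.lift f (surfaceRelator g) = 1 := by
  unfold surfaceRelator
  rw [map_list_prod, List.map_map]
  apply List.prod_eq_one
  intro x hx
  rw [List.mem_map] at hx
  obtain ⟨i, -, rfl⟩ := hx
  simp [genA, genB, mul_inv_cancel_comm]

/-- Any generator assignment into a commutative group extends to a hom out of `S_g`. -/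
def commHom {C : Type*} [CommGroup C] (f : surfaceGen g → C) : SurfaceGroup g →* C :=
  PresentedGroup.toGroup (f := f) (by
    intro r hr
    rw [Set.mem_singleton_iff] at hr
    subst hr
    exact lift_surfaceRelator_eq_one_of_comm f)

@[simp] theorem commHom_of {C : Type*} [CommGroup C] (f : surfaceGen g → C) (x : surfaceGen g) :
    commHom f (PresentedGroup.of x) = f x :=
  PresentedGroup.toGroup.of _

/-- Symmetry of the pairwise quotient in `i, j`. -/
theorem isFreeOfRank_pairQuotient_symm {K : TrisectionKernels g} {i j : Fin 3} {k : ℕ}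
    (h : IsFreeOfRank (K.pairQuotient i j) k) : IsFreeOfRank (K.pairQuotient j i) k :=
  h.of_mulEquiv (QuotientGroup.quotientMulEquivOfEq (by rw [Set.union_comm]))

/-- `free_quotient` asks for the quotient by `normalClosure ↑(K i)`; for normal `K i` this is the
quotient by `K i`. -/
theorem isFreeOfRank_quotient_normalClosure_iff (N : Subgroup (SurfaceGroup g)) [N.Normal] (n : ℕ) :
    IsFreeOfRank (SurfaceGroup g ⧸ normalClosure (N : Set (SurfaceGroup g))) n ↔
      IsFreeOfRank (SurfaceGroup g ⧸ N) n :=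
  ⟨fun h => h.of_mulEquiv (QuotientGroup.quotientMulEquivOfEq (normalClosure_eq_self N)),
    fun h => h.of_mulEquiv (QuotientGroup.quotientMulEquivOfEq (normalClosure_eq_self N).symm)⟩

end Toolkit

/-! ## 5. Refuted strengthening I: the balance condition `g = 3k` is load-bearing
(`ℂP²`'s genus-one `(1, 0)` trisection of the trivial group is not stably trivial) -/

section CP2

/-- The generator `a` of `S_1 = ⟨a, b ∣ [a,b]⟩ ≅ ℤ²`. -/
abbrev ta : SurfaceGroup 1 := PresentedGroup.of (0, false)
/-- The generator `b` of `S_1`. -/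
abbrev tb : SurfaceGroup 1 := PresentedGroup.of (0, true)

/-- The kernel triple of the genus-`1` `(1; 0,0,0)` trisection of `ℂP²`: `⟪a⟫, ⟪b⟫, ⟪ab⟫` (the
curves of slope `0`, `∞`, `1` on the torus; Gay–Kirby 2016, §2). -/
def cp2Kernels : TrisectionKernels 1 :=
  ![normalClosure {ta}, normalClosure {tb}, normalClosure {ta * tb}]

theorem cp2Kernels_zero : cp2Kernels 0 = normalClosure {ta} := rfl
theorem cp2Kernels_one : cp2Kernels 1 = normalClosure {tb} := rfl
theorem cp2Kernels_two : cp2Kernels 2 = normalClosure {ta * tb} := rfl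

instance cp2Kernels_normal (i : Fin 3) : (cp2Kernels i).Normal := by
  fin_cases i <;> simp [cp2Kernels] <;> infer_instance

theorem ta_mem : ta ∈ cp2Kernels 0 := subset_normalClosure rfl
theorem tb_mem : tb ∈ cp2Kernels 1 := subset_normalClosure rfl
theorem tab_mem : ta * tb ∈ cp2Kernels 2 := subset_normalClosure rfl

/-- `S_1 / ⟪a⟫ ≅ F_1` (the survivor is `b`). -/
theorem isFreeOfRank_quotient_cp2Kernels_zero : IsFreeOfRank (SurfaceGroup 1 ⧸ cp2Kernels 0) 1 := by
  refine isFreeOfRank_quotient_of_erase (n := 1) {((0 : Fin 1), false)} (fun i => ?_) _ ?_ ?_ (by decide)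
  · left; obtain rfl : i = 0 := Subsingleton.elim _ _; simp
  · intro x hx
    rw [Finset.mem_singleton] at hx
    subst hx
    exact ta_mem
  · rw [cp2Kernels_zero]
    exact normalClosure_le_normal (Set.singleton_subset_iff.2
      (of_mem_ker_eraseHom _ _ (Finset.mem_singleton_self _)))

/-- `S_1 / ⟪b⟫ ≅ F_1` (the survivor is `a`). -/
theorem isFreeOfRank_quotient_cp2Kernels_one : IsFreeOfRank (SurfaceGroup 1 ⧸ cp2Kernels 1) 1 := by
  refine isFreeOfRank_quotient_of_erase (n := 1) {((0 : Fin 1), true)} (fun i => ?_) _ ?_ ?_ (by decide)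
  · right; obtain rfl : i = 0 := Subsingleton.elim _ _; simp
  · intro x hx
    rw [Finset.mem_singleton] at hx
    subst hx
    exact tb_mem
  · rw [cp2Kernels_one]
    exact normalClosure_le_normal (Set.singleton_subset_iff.2
      (of_mem_ker_eraseHom _ _ (Finset.mem_singleton_self _)))

/-- The hom `S_1 → F_1`, `a ↦ x`, `b ↦ x⁻¹`, killing `ab` (and the relator `[a,b] ↦ [x,x⁻¹] = 1`). -/
def cp2HomTwo : SurfaceGroup 1 →* FreeGroup (Fin 1) :=
  PresentedGroup.toGroup (f := fun p => if p.2 then (FreeGroup.of 0)⁻¹ else FreeGroup.of 0) (by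
    intro r hr
    rw [Set.mem_singleton_iff] at hr
    subst hr
    simp [surfaceRelator, genA, genB, List.finRange_succ])

@[simp] theorem cp2HomTwo_of (p : surfaceGen 1) :
    cp2HomTwo (PresentedGroup.of p) = if p.2 then (FreeGroup.of 0)⁻¹ else FreeGroup.of 0 :=
  PresentedGroup.toGroup.of _

@[simp] theorem cp2HomTwo_ta : cp2HomTwo ta = FreeGroup.of 0 := by simp [ta]
@[simp] theorem cp2HomTwo_tb : cp2HomTwo tb = (FreeGroup.of 0)⁻¹ := by simp [tb]

theorem cp2Kernels_two_le_ker : cp2Kernels 2 ≤ cp2HomTwo.ker := by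
  rw [cp2Kernels_two]
  exact normalClosure_le_normal (Set.singleton_subset_iff.2 (by simp [MonoidHom.mem_ker]))

/-- `S_1 / ⟪ab⟫ ≅ F_1`. -/
def quotientCp2KernelsTwoEquiv : SurfaceGroup 1 ⧸ cp2Kernels 2 ≃* FreeGroup (Fin 1) :=
  MonoidHom.toMulEquiv (QuotientGroup.lift _ cp2HomTwo cp2Kernels_two_le_ker)
    (FreeGroup.lift fun _ => (QuotientGroup.mk ta : SurfaceGroup 1 ⧸ cp2Kernels 2))
    (by
      apply QuotientGroup.monoidHom_ext
      apply PresentedGroup.ext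
      rintro ⟨i, b⟩
      obtain rfl : i = 0 := Subsingleton.elim _ _
      simp only [MonoidHom.comp_apply, MonoidHom.id_apply, QuotientGroup.mk'_apply,
        QuotientGroup.lift_mk]
      cases b
      · rw [cp2HomTwo_ta, FreeGroup.lift_apply_of]
      · rw [cp2HomTwo_tb, map_inv, FreeGroup.lift_apply_of, ← QuotientGroup.mk_inv, QuotientGroup.eq,
          inv_inv]
        exact tab_mem)
    (by
      apply FreeGroup.ext_hom
      intro i
      obtain rfl : i = 0 := Subsingleton.elim _ _
      simp only [MonoidHom.comp_apply, MonoidHom.id_apply, FreeGroup.lift_apply_of,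
        QuotientGroup.lift_mk, cp2HomTwo_ta])

/-- **The genus-one trisection of `ℂP²` is a `(1, 0)` group trisection of the trivial group.** -/
theorem cp2Kernels_isGroupTrisection : IsGroupTrisection 1 0 (PUnit : Type) cp2Kernels where
  normal := cp2Kernels_normal
  free_quotient i := by
    rw [isFreeOfRank_quotient_normalClosure_iff]
    fin_cases i
    · exact isFreeOfRank_quotient_cp2Kernels_zero
    · exact isFreeOfRank_quotient_cp2Kernels_one
    · exact ⟨quotientCp2KernelsTwoEquiv.symm⟩
  free_pairQuotient i j hij := by
    haveI : Subsingleton (cp2Kernels.pairQuotient i j) := by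
      refine subsingleton_quotient_of_forall_of_mem _ ?_
      have hsub : ∀ l l' : Fin 3, (cp2Kernels l : Set (SurfaceGroup 1)) ∪ cp2Kernels l' ⊆
          normalClosure ((cp2Kernels l : Set (SurfaceGroup 1)) ∪ cp2Kernels l') :=
        fun _ _ => subset_normalClosure
      have key : ta ∈ normalClosure ((cp2Kernels i : Set (SurfaceGroup 1)) ∪ cp2Kernels j) ∧
          tb ∈ normalClosure ((cp2Kernels i : Set (SurfaceGroup 1)) ∪ cp2Kernels j) := by
        fin_cases i <;> fin_cases j
        · exact absurd rfl hij
        · exact ⟨hsub _ _ (Or.inl ta_mem), hsub _ _ (Or.inr tb_mem)⟩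
        · refine ⟨hsub _ _ (Or.inl ta_mem), ?_⟩
          have h := mul_mem (inv_mem (hsub _ _ (Or.inl ta_mem))) (hsub 0 2 (Or.inr tab_mem))
          rwa [inv_mul_cancel_left] at h
        · exact ⟨hsub _ _ (Or.inr ta_mem), hsub _ _ (Or.inl tb_mem)⟩
        · exact absurd rfl hij
        · refine ⟨?_, hsub _ _ (Or.inl tb_mem)⟩
          have h := mul_mem (hsub 1 2 (Or.inr tab_mem)) (inv_mem (hsub _ _ (Or.inl tb_mem)))
          rwa [mul_inv_cancel_right] at h
        · refine ⟨hsub _ _ (Or.inr ta_mem), ?_⟩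
          have h := mul_mem (inv_mem (hsub _ _ (Or.inr ta_mem))) (hsub 2 0 (Or.inl tab_mem))
          rwa [inv_mul_cancel_left] at h
        · refine ⟨?_, hsub _ _ (Or.inr tb_mem)⟩
          have h := mul_mem (hsub 2 1 (Or.inl tab_mem)) (inv_mem (hsub _ _ (Or.inr tb_mem)))
          rwa [mul_inv_cancel_right] at h
        · exact absurd rfl hij
      rintro ⟨l, c⟩
      obtain rfl : l = 0 := Subsingleton.elim _ _
      cases c
      · exact key.1
      · exact key.2
    exact isFreeOfRank_zero_of_subsingleton _
  triple := by
    haveI : Subsingleton cp2Kernels.tripleQuotient := by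
      refine subsingleton_quotient_of_forall_of_mem _ ?_
      rintro ⟨l, c⟩
      obtain rfl : l = 0 := Subsingleton.elim _ _
      cases c
      · exact subset_normalClosure (Set.mem_iUnion.2 ⟨0, ta_mem⟩)
      · exact subset_normalClosure (Set.mem_iUnion.2 ⟨1, tb_mem⟩)
    letI : Unique cp2Kernels.tripleQuotient := uniqueOfSubsingleton 1
    exact ⟨MulEquiv.ofUnique⟩

/-- … and it is **not stably trivial**: stabilisation preserves `g - 3k`, here `1 ≠ 0`
(`isStablyTrivial_tight`; concretely the genus equation `3 + 3m = 1 + 3n` has no solution). -/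
theorem not_isStablyTrivial_cp2Kernels : ¬ cp2Kernels.IsStablyTrivial := fun h => by
  have := (isStablyTrivial_tight cp2Kernels_isGroupTrisection h).1
  omega

/-- AGK's hypothesis with the balance condition `g = 3k` dropped. -/
def AgkHypothesisUnbalanced : Prop :=
  ∀ (g k : ℕ) (K : TrisectionKernels g), IsGroupTrisection g k (PUnit : Type) K → K.IsStablyTrivial

/-- **Refuted strengthening I.**  Without `g = 3k`, "every group trisection of the trivial group is
stably trivial" is false: witness the `(1,0)` trisection of `ℂP²`.  (So `X` cannot be attacked
through any statement insensitive to the Euler characteristic `χ = 2 + g - 3k`.) -/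
theorem not_agkHypothesisUnbalanced : ¬ AgkHypothesisUnbalanced := fun h =>
  not_isStablyTrivial_cp2Kernels (h 1 0 cp2Kernels cp2Kernels_isGroupTrisection)

end CP2


/-! ## 6. Refuted strengthening II: triviality of the group is load-bearing
(the `(3,1)` trisection of `S¹ × S³ # ℂP² # ℂP²`, a group trisection of `ℤ`, is not stably trivial) -/

section AnyGroup

/-- Generators of `S_3`. -/
abbrev za (i : Fin 3) : SurfaceGroup 3 := PresentedGroup.of (i, false)
abbrev zb (i : Fin 3) : SurfaceGroup 3 := PresentedGroup.of (i, true)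

/-- Kernel triple of the `(3,1)` trisection of `S¹ × S³ # ℂP² # ℂP²` (`π₁ = ℤ`, `χ = 2`):
handle 0 carries `(a, a, a)` (the genus-one trisection of `S¹ × S³`), handles 1, 2 carry `(a, b, ab)`
(`ℂP²`). -/
def zKernels : TrisectionKernels 3 :=
  ![normalClosure {za 0, za 1, za 2}, normalClosure {za 0, zb 1, zb 2},
    normalClosure {za 0, za 1 * zb 1, za 2 * zb 2}]

theorem zKernels_zero : zKernels 0 = normalClosure {za 0, za 1, za 2} := rfl
theorem zKernels_one : zKernels 1 = normalClosure {za 0, zb 1, zb 2} := rfl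
theorem zKernels_two : zKernels 2 = normalClosure {za 0, za 1 * zb 1, za 2 * zb 2} := rfl

instance zKernels_normal (i : Fin 3) : (zKernels i).Normal := by
  fin_cases i <;> simp [zKernels] <;> infer_instance

theorem za0_mem (i : Fin 3) : za 0 ∈ zKernels i := by
  fin_cases i <;> exact subset_normalClosure (by simp)
theorem za1_mem_zero : za 1 ∈ zKernels 0 := subset_normalClosure (by simp)
theorem za2_mem_zero : za 2 ∈ zKernels 0 := subset_normalClosure (by simp)
theorem zb1_mem_one : zb 1 ∈ zKernels 1 := subset_normalClosure (by simp)
theorem zb2_mem_one : zb 2 ∈ zKernels 1 := subset_normalClosure (by simp)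
theorem zab1_mem_two : za 1 * zb 1 ∈ zKernels 2 := subset_normalClosure (by simp)
theorem zab2_mem_two : za 2 * zb 2 ∈ zKernels 2 := subset_normalClosure (by simp)

/-- The `a`-curves `{a₀, a₁, a₂}` and the mixed system `{a₀, b₁, b₂}` as generator sets. -/
def zGensA : Finset (surfaceGen 3) := {((0 : Fin 3), false), ((1 : Fin 3), false), ((2 : Fin 3), false)}
def zGensB : Finset (surfaceGen 3) := {((0 : Fin 3), false), ((1 : Fin 3), true), ((2 : Fin 3), true)}
/-- Everything but `b₀` (killed by any two of the three kernels). -/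
def zGensPair : Finset (surfaceGen 3) := Finset.univ.erase ((0 : Fin 3), true)

theorem zGensA_hits (k : Fin 3) : (k, false) ∈ zGensA ∨ (k, true) ∈ zGensA := by
  fin_cases k <;> decide
theorem zGensB_hits (k : Fin 3) : (k, false) ∈ zGensB ∨ (k, true) ∈ zGensB := by
  fin_cases k <;> decide
theorem zGensPair_hits (k : Fin 3) : (k, false) ∈ zGensPair ∨ (k, true) ∈ zGensPair := by
  fin_cases k <;> decide

/-- `S_3 / ⟪a₀, a₁, a₂⟫ ≅ F_3`. -/
theorem isFreeOfRank_quotient_zKernels_zero : IsFreeOfRank (SurfaceGroup 3 ⧸ zKernels 0) 3 := by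
  refine isFreeOfRank_quotient_of_erase (n := 3) zGensA zGensA_hits _ ?_ ?_ (by decide)
  · intro x hx
    simp only [zGensA, Finset.mem_insert, Finset.mem_singleton] at hx
    rcases hx with rfl | rfl | rfl
    · exact za0_mem 0
    · exact za1_mem_zero
    · exact za2_mem_zero
  · rw [zKernels_zero]
    refine normalClosure_le_normal ?_
    simp only [Set.insert_subset_iff, Set.singleton_subset_iff, SetLike.mem_coe]
    exact ⟨of_mem_ker_eraseHom _ _ (by decide), of_mem_ker_eraseHom _ _ (by decide),
      of_mem_ker_eraseHom _ _ (by decide)⟩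

/-- `S_3 / ⟪a₀, b₁, b₂⟫ ≅ F_3`. -/
theorem isFreeOfRank_quotient_zKernels_one : IsFreeOfRank (SurfaceGroup 3 ⧸ zKernels 1) 3 := by
  refine isFreeOfRank_quotient_of_erase (n := 3) zGensB zGensB_hits _ ?_ ?_ (by decide)
  · intro x hx
    simp only [zGensB, Finset.mem_insert, Finset.mem_singleton] at hx
    rcases hx with rfl | rfl | rfl
    · exact za0_mem 1
    · exact zb1_mem_one
    · exact zb2_mem_one
  · rw [zKernels_one]
    refine normalClosure_le_normal ?_
    simp only [Set.insert_subset_iff, Set.singleton_subset_iff, SetLike.mem_coe]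
    exact ⟨of_mem_ker_eraseHom _ _ (by decide), of_mem_ker_eraseHom _ _ (by decide),
      of_mem_ker_eraseHom _ _ (by decide)⟩

/-- Images of the `a`- and `b`-generators under `S_3 → F_3 = F⟨x₀,x₁,x₂⟩`:
`a₀ ↦ 1, a₁ ↦ x₁, a₂ ↦ x₂`, `b₀ ↦ x₀, b₁ ↦ x₁⁻¹, b₂ ↦ x₂⁻¹`. -/
def zImgA : Fin 3 → FreeGroup (Fin 3) := ![1, FreeGroup.of 1, FreeGroup.of 2]
def zImgB : Fin 3 → FreeGroup (Fin 3) := ![FreeGroup.of 0, (FreeGroup.of 1)⁻¹, (FreeGroup.of 2)⁻¹]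

@[simp] theorem zImgA_zero : zImgA 0 = 1 := rfl
@[simp] theorem zImgA_one : zImgA 1 = FreeGroup.of 1 := rfl
@[simp] theorem zImgA_two : zImgA 2 = FreeGroup.of 2 := rfl
@[simp] theorem zImgB_zero : zImgB 0 = FreeGroup.of 0 := rfl
@[simp] theorem zImgB_one : zImgB 1 = (FreeGroup.of 1)⁻¹ := rfl
@[simp] theorem zImgB_two : zImgB 2 = (FreeGroup.of 2)⁻¹ := rfl

/-- The hom `S_3 → F_3` killing `⟪a₀, a₁b₁, a₂b₂⟫`. -/
def zHomTwo : SurfaceGroup 3 →* FreeGroup (Fin 3) :=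
  PresentedGroup.toGroup (f := fun p => if p.2 then zImgB p.1 else zImgA p.1) (by
    intro r hr
    rw [Set.mem_singleton_iff] at hr
    subst hr
    simp [surfaceRelator, genA, genB, List.finRange_succ, Fin.succ])

@[simp] theorem zHomTwo_za (i : Fin 3) : zHomTwo (za i) = zImgA i := by
  simp [zHomTwo, za]
@[simp] theorem zHomTwo_zb (i : Fin 3) : zHomTwo (zb i) = zImgB i := by
  simp [zHomTwo, zb]

theorem zKernels_two_le_ker : zKernels 2 ≤ zHomTwo.ker := by
  rw [zKernels_two]
  refine normalClosure_le_normal ?_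
  simp only [Set.insert_subset_iff, Set.singleton_subset_iff, SetLike.mem_coe, MonoidHom.mem_ker,
    map_mul, zHomTwo_za, zHomTwo_zb]
  simp

/-- The three survivors `b₀, a₁, a₂` in the quotient `S_3 / ⟪a₀, a₁b₁, a₂b₂⟫`. -/
def zSurv : Fin 3 → SurfaceGroup 3 ⧸ zKernels 2 :=
  ![QuotientGroup.mk (zb 0), QuotientGroup.mk (za 1), QuotientGroup.mk (za 2)]

@[simp] theorem zSurv_zero : zSurv 0 = QuotientGroup.mk (zb 0) := rfl
@[simp] theorem zSurv_one : zSurv 1 = QuotientGroup.mk (za 1) := rfl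
@[simp] theorem zSurv_two : zSurv 2 = QuotientGroup.mk (za 2) := rfl

/-- `S_3 / ⟪a₀, a₁b₁, a₂b₂⟫ ≅ F_3`. -/
def quotientZKernelsTwoEquiv : SurfaceGroup 3 ⧸ zKernels 2 ≃* FreeGroup (Fin 3) :=
  MonoidHom.toMulEquiv (QuotientGroup.lift _ zHomTwo zKernels_two_le_ker) (FreeGroup.lift zSurv)
    (by
      apply QuotientGroup.monoidHom_ext
      apply PresentedGroup.ext
      rintro ⟨i, c⟩
      simp only [MonoidHom.comp_apply, MonoidHom.id_apply, QuotientGroup.mk'_apply,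
        QuotientGroup.lift_mk]
      fin_cases i <;> cases c
      · -- a₀ ↦ 1 ↦ 1 = [a₀]
        rw [show ((⟨0, by omega⟩ : Fin 3), false) = ((0 : Fin 3), false) from rfl, zHomTwo_za,
          zImgA_zero, map_one]
        exact ((QuotientGroup.eq_one_iff _).2 (za0_mem 2)).symm
      · rw [show ((⟨0, by omega⟩ : Fin 3), true) = ((0 : Fin 3), true) from rfl, zHomTwo_zb,
          zImgB_zero, FreeGroup.lift_apply_of, zSurv_zero]
      · rw [show ((⟨1, by omega⟩ : Fin 3), false) = ((1 : Fin 3), false) from rfl, zHomTwo_za,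
          zImgA_one, FreeGroup.lift_apply_of, zSurv_one]
      · rw [show ((⟨1, by omega⟩ : Fin 3), true) = ((1 : Fin 3), true) from rfl, zHomTwo_zb,
          zImgB_one, map_inv, FreeGroup.lift_apply_of, zSurv_one, ← QuotientGroup.mk_inv,
          QuotientGroup.eq, inv_inv]
        exact zab1_mem_two
      · rw [show ((⟨2, by omega⟩ : Fin 3), false) = ((2 : Fin 3), false) from rfl, zHomTwo_za,
          zImgA_two, FreeGroup.lift_apply_of, zSurv_two]
      · rw [show ((⟨2, by omega⟩ : Fin 3), true) = ((2 : Fin 3), true) from rfl, zHomTwo_zb,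
          zImgB_two, map_inv, FreeGroup.lift_apply_of, zSurv_two, ← QuotientGroup.mk_inv,
          QuotientGroup.eq, inv_inv]
        exact zab2_mem_two)
    (by
      apply FreeGroup.ext_hom
      intro i
      simp only [MonoidHom.comp_apply, MonoidHom.id_apply, FreeGroup.lift_apply_of]
      fin_cases i
      · rw [show (⟨0, by omega⟩ : Fin 3) = 0 from rfl, zSurv_zero, QuotientGroup.lift_mk, zHomTwo_zb,
          zImgB_zero]
      · rw [show (⟨1, by omega⟩ : Fin 3) = 1 from rfl, zSurv_one, QuotientGroup.lift_mk, zHomTwo_za,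
          zImgA_one]
      · rw [show (⟨2, by omega⟩ : Fin 3) = 2 from rfl, zSurv_two, QuotientGroup.lift_mk, zHomTwo_za,
          zImgA_two])


/-- Pairwise quotients of `zKernels`: any two kernels kill everything but `b₀`, so the quotient is
`F_1` — the three direct cases `(0,1)`, `(0,2)`, `(1,2)`. -/
theorem isFreeOfRank_pairQuotient_zKernels_of_lt (i j : Fin 3) (hij : i < j) :
    IsFreeOfRank (zKernels.pairQuotient i j) 1 := by
  -- the normal closure of `K i ∪ K j`
  have hsub : ∀ l l' : Fin 3, (zKernels l : Set (SurfaceGroup 3)) ∪ zKernels l' ⊆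
      normalClosure ((zKernels l : Set (SurfaceGroup 3)) ∪ zKernels l') :=
    fun _ _ => subset_normalClosure
  -- every kernel is killed by erasing `zGensPair` (all generators but `b₀`)
  have hker : ∀ l, zKernels l ≤ (eraseHom zGensPair zGensPair_hits).ker := by
    intro l
    fin_cases l
    · rw [show (⟨0, by omega⟩ : Fin 3) = 0 from rfl, zKernels_zero]
      refine normalClosure_le_normal ?_
      simp only [Set.insert_subset_iff, Set.singleton_subset_iff, SetLike.mem_coe]
      exact ⟨of_mem_ker_eraseHom _ _ (by decide), of_mem_ker_eraseHom _ _ (by decide),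
        of_mem_ker_eraseHom _ _ (by decide)⟩
    · rw [show (⟨1, by omega⟩ : Fin 3) = 1 from rfl, zKernels_one]
      refine normalClosure_le_normal ?_
      simp only [Set.insert_subset_iff, Set.singleton_subset_iff, SetLike.mem_coe]
      exact ⟨of_mem_ker_eraseHom _ _ (by decide), of_mem_ker_eraseHom _ _ (by decide),
        of_mem_ker_eraseHom _ _ (by decide)⟩
    · rw [show (⟨2, by omega⟩ : Fin 3) = 2 from rfl, zKernels_two]
      refine normalClosure_le_normal ?_
      simp only [Set.insert_subset_iff, Set.singleton_subset_iff, SetLike.mem_coe]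
      exact ⟨of_mem_ker_eraseHom _ _ (by decide),
        mul_mem (of_mem_ker_eraseHom _ _ (by decide)) (of_mem_ker_eraseHom _ _ (by decide)),
        mul_mem (of_mem_ker_eraseHom _ _ (by decide)) (of_mem_ker_eraseHom _ _ (by decide))⟩
  have hN₂ : normalClosure ((zKernels i : Set (SurfaceGroup 3)) ∪ zKernels j) ≤
      (eraseHom zGensPair zGensPair_hits).ker :=
    normalClosure_le_normal (Set.union_subset (hker i) (hker j))
  -- the five erased generators lie in the normal closure, case by case
  have hN₁ : ∀ x ∈ zGensPair, (PresentedGroup.of x : SurfaceGroup 3) ∈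
      normalClosure ((zKernels i : Set (SurfaceGroup 3)) ∪ zKernels j) := by
    have ha0 : za 0 ∈ normalClosure ((zKernels i : Set (SurfaceGroup 3)) ∪ zKernels j) :=
      hsub _ _ (Or.inl (za0_mem i))
    fin_cases i <;> fin_cases j <;> try exact absurd hij (by decide)
    · -- (0,1)
      have ha1 := hsub 0 1 (Or.inl za1_mem_zero)
      have ha2 := hsub 0 1 (Or.inl za2_mem_zero)
      have hb1 := hsub 0 1 (Or.inr zb1_mem_one)
      have hb2 := hsub 0 1 (Or.inr zb2_mem_one)
      intro x hx
      fin_cases x <;> simp (config := {decide := true}) at hx <;> assumption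
    · -- (0,2)
      have ha1 := hsub 0 2 (Or.inl za1_mem_zero)
      have ha2 := hsub 0 2 (Or.inl za2_mem_zero)
      have hb1 : zb 1 ∈ normalClosure ((zKernels 0 : Set (SurfaceGroup 3)) ∪ zKernels 2) := by
        have h := mul_mem (inv_mem ha1) (hsub 0 2 (Or.inr zab1_mem_two))
        rwa [inv_mul_cancel_left] at h
      have hb2 : zb 2 ∈ normalClosure ((zKernels 0 : Set (SurfaceGroup 3)) ∪ zKernels 2) := by
        have h := mul_mem (inv_mem ha2) (hsub 0 2 (Or.inr zab2_mem_two))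
        rwa [inv_mul_cancel_left] at h
      intro x hx
      fin_cases x <;> simp (config := {decide := true}) at hx <;> assumption
    · -- (1,2)
      have hb1 := hsub 1 2 (Or.inl zb1_mem_one)
      have hb2 := hsub 1 2 (Or.inl zb2_mem_one)
      have ha1 : za 1 ∈ normalClosure ((zKernels 1 : Set (SurfaceGroup 3)) ∪ zKernels 2) := by
        have h := mul_mem (hsub 1 2 (Or.inr zab1_mem_two)) (inv_mem hb1)
        rwa [mul_inv_cancel_right] at h
      have ha2 : za 2 ∈ normalClosure ((zKernels 1 : Set (SurfaceGroup 3)) ∪ zKernels 2) := by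
        have h := mul_mem (hsub 1 2 (Or.inr zab2_mem_two)) (inv_mem hb2)
        rwa [mul_inv_cancel_right] at h
      intro x hx
      fin_cases x <;> simp (config := {decide := true}) at hx <;> assumption
  exact isFreeOfRank_quotient_of_erase (n := 1) zGensPair zGensPair_hits _ hN₁ hN₂ (by decide)

/-- **`zKernels` is a `(3,1)` group trisection of its (non-trivial) triple quotient `ℤ`.** -/
theorem zKernels_isGroupTrisection : IsGroupTrisection 3 1 zKernels.tripleQuotient zKernels where
  normal := zKernels_normal
  free_quotient i := by
    rw [isFreeOfRank_quotient_normalClosure_iff]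
    fin_cases i
    · exact isFreeOfRank_quotient_zKernels_zero
    · exact isFreeOfRank_quotient_zKernels_one
    · exact ⟨quotientZKernelsTwoEquiv.symm⟩
  free_pairQuotient i j hij := by
    rcases lt_or_gt_of_ne hij with h | h
    · exact isFreeOfRank_pairQuotient_zKernels_of_lt i j h
    · exact isFreeOfRank_pairQuotient_symm (isFreeOfRank_pairQuotient_zKernels_of_lt j i h)
  triple := ⟨MulEquiv.refl _⟩

/-- The indicator of `b₀` into `ℤ/2`: a generator assignment killing all three kernels. -/
def zDetect : surfaceGen 3 → Multiplicative (ZMod 2) :=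
  fun p => if p = ((0 : Fin 3), true) then Multiplicative.ofAdd 1 else 1

theorem zKernels_le_ker_commHom_zDetect (l : Fin 3) : zKernels l ≤ (commHom zDetect).ker := by
  fin_cases l
  · rw [show (⟨0, by omega⟩ : Fin 3) = 0 from rfl, zKernels_zero]
    refine normalClosure_le_normal ?_
    simp only [Set.insert_subset_iff, Set.singleton_subset_iff, SetLike.mem_coe, MonoidHom.mem_ker,
      commHom_of, zDetect]
    decide
  · rw [show (⟨1, by omega⟩ : Fin 3) = 1 from rfl, zKernels_one]
    refine normalClosure_le_normal ?_
    simp only [Set.insert_subset_iff, Set.singleton_subset_iff, SetLike.mem_coe, MonoidHom.mem_ker,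
      commHom_of, zDetect]
    decide
  · rw [show (⟨2, by omega⟩ : Fin 3) = 2 from rfl, zKernels_two]
    refine normalClosure_le_normal ?_
    simp only [Set.insert_subset_iff, Set.singleton_subset_iff, SetLike.mem_coe, MonoidHom.mem_ker,
      map_mul, commHom_of, zDetect]
    decide

/-- The triple quotient of `zKernels` surjects onto `ℤ/2` (it is `ℤ`, generated by `b₀`); in
particular it is **not trivial**. -/
theorem not_subsingleton_tripleQuotient_zKernels : ¬ Subsingleton zKernels.tripleQuotient := by
  intro hs
  have hle : normalClosure (⋃ l, (zKernels l : Set (SurfaceGroup 3))) ≤ (commHom zDetect).ker :=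
    normalClosure_le_normal (Set.iUnion_subset fun l => zKernels_le_ker_commHom_zDetect l)
  have h1 : (QuotientGroup.mk (zb 0) : zKernels.tripleQuotient) = 1 := Subsingleton.elim _ _
  have h2 := congrArg (QuotientGroup.lift _ (commHom zDetect) hle) h1
  rw [QuotientGroup.lift_mk, map_one, commHom_of] at h2
  revert h2
  decide

/-- … hence `zKernels` is **not stably trivial** (`isStablyTrivial_tight`: the triple quotient of a
stably trivial triple is trivial). -/
theorem not_isStablyTrivial_zKernels : ¬ zKernels.IsStablyTrivial := fun h => by
  obtain ⟨e⟩ := (isStablyTrivial_tight zKernels_isGroupTrisection h).2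
  exact not_subsingleton_tripleQuotient_zKernels e.toEquiv.subsingleton

/-- AGK's hypothesis with the group allowed to be arbitrary (only the numerics `(3k, k)` kept). -/
def AgkHypothesisAnyGroup : Prop :=
  ∀ (k : ℕ) (G : Type) [Group G] (K : TrisectionKernels (3 * k)),
    IsGroupTrisection (3 * k) k G K → K.IsStablyTrivial

/-- **Refuted strengthening II.**  With the numerics `(3k, k)` but an arbitrary group, "every group
trisection is stably trivial" is false: witness the `(3,1)` trisection of `S¹ × S³ # ℂP² # ℂP²`
(`χ = 2`, `π₁ = ℤ`).  So `X` genuinely lives on the trivial group: `χ = 2` alone does not force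
stable triviality. -/
theorem not_agkHypothesisAnyGroup : ¬ AgkHypothesisAnyGroup := fun h =>
  not_isStablyTrivial_zKernels (h 1 _ zKernels zKernels_isGroupTrisection)

end AnyGroup

/-! ## 7. The hypothesis is downward closed in `k`: its eventual form suffices for free -/

section Downward

variable {g : ℕ}

/-- Transport of a transport. -/
theorem cast_cast {g g' g'' : ℕ} (K : TrisectionKernels g) (h : g = g') (h' : g' = g'') :
    (K.cast h).cast h' = K.cast (h.trans h') := by
  subst h; subst h'; rfl

/-- Stabilisation commutes with transport. -/
theorem stabilize_cast {g g' : ℕ} (K : TrisectionKernels g) (h : g = g') :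
    (K.cast h).stabilize = K.stabilize.cast (by rw [h]) := by
  subst h; rfl

/-- Iterated stabilisation commutes with transport. -/
theorem stabilizeIter_cast {g g' : ℕ} (K : TrisectionKernels g) (h : g = g') (n : ℕ) :
    (K.cast h).stabilizeIter n = (K.stabilizeIter n).cast (by rw [h]) := by
  subst h; rfl

/-- `Iso` is transport-invariant (both sides). -/
theorem iso_cast_iff {g g' : ℕ} (h : g = g') (A B : TrisectionKernels g) :
    TrisectionKernels.Iso (A.cast h) (B.cast h) ↔ TrisectionKernels.Iso A B := by
  subst h; rfl

/-- **Stabilising `a` times and then `b` times is stabilising `a + b` times** (up to the transport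
`g + 3(a+b) = (g + 3a) + 3b`). -/
theorem stabilizeIter_add (K : TrisectionKernels g) (a : ℕ) :
    ∀ b : ℕ, (K.stabilizeIter a).stabilizeIter b = (K.stabilizeIter (a + b)).cast (by omega)
  | 0 => rfl
  | b + 1 => by
    show ((K.stabilizeIter a).stabilizeIter b).stabilize = (K.stabilizeIter (a + b)).stabilize.cast _
    rw [stabilizeIter_add K a b, stabilize_cast]

/-- **Stable triviality descends along stabilisation**: if some stabilisation of `K` is stably
trivial, so is `K`. -/
theorem isStablyTrivial_of_stabilizeIter (K : TrisectionKernels g) (j : ℕ)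
    (h : (K.stabilizeIter j).IsStablyTrivial) : K.IsStablyTrivial := by
  obtain ⟨n, m, e, hiso⟩ := h
  rw [stabilizeIter_add] at hiso
  refine ⟨j + n, m, by omega, ?_⟩
  have e' : 3 + 3 * m = g + 3 * (j + n) := by omega
  rw [show (s4Kernels.stabilizeIter m).cast e = ((s4Kernels.stabilizeIter m).cast e').cast (by omega) by
    rw [cast_cast]] at hiso
  exact (iso_cast_iff _ _ _).1 hiso

/-- **AGK's condition is downward closed in `k`.**  If every `(3k₀, k₀)` group trisection of the
trivial group is stably trivial, then so is every `(3k, k)` one for `k ≤ k₀` (stabilise `k₀ - k`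
times).  Consequently the crux's hypothesis may be weakened, for free, to "AGK's condition holds for
infinitely many `k`" / "for all sufficiently large `k`". -/
theorem agkCondition_downward {k₀ : ℕ}
    (h : ∀ K : TrisectionKernels (3 * k₀), IsGroupTrisection (3 * k₀) k₀ (PUnit : Type) K → K.IsStablyTrivial)
    {k : ℕ} (hk : k ≤ k₀) (K : TrisectionKernels (3 * k))
    (hK : IsGroupTrisection (3 * k) k (PUnit : Type) K) : K.IsStablyTrivial := by
  obtain ⟨j, rfl⟩ := Nat.exists_eq_add_of_le hk
  have hj := isGroupTrisection_stabilizeIter hK j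
  have e : 3 * k + 3 * j = 3 * (k + j) := by omega
  have hst := h _ (isGroupTrisection_cast hj e)
  rw [isStablyTrivial_cast_iff] at hst
  exact isStablyTrivial_of_stabilizeIter K j hst

/-- **Eventual form of AGK's condition suffices**: "for every `k₀` there is `k ≥ k₀` at which AGK's
condition holds" already gives it at every `k`. -/
theorem agkCondition_of_frequently
    (h : ∀ k₀ : ℕ, ∃ k, k₀ ≤ k ∧ ∀ K : TrisectionKernels (3 * k),
      IsGroupTrisection (3 * k) k (PUnit : Type) K → K.IsStablyTrivial)
    (k : ℕ) (K : TrisectionKernels (3 * k)) (hK : IsGroupTrisection (3 * k) k (PUnit : Type) K) :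
    K.IsStablyTrivial := by
  obtain ⟨k₁, hk₁, h₁⟩ := h k
  exact agkCondition_downward h₁ hk₁ K hK


end Downward

/-- **The crux with the formally weaker, eventual hypothesis is the same crux.**  Since AGK's
condition is downward closed, `AgkCor6Sufficiency` is equivalent to "AGK's condition at infinitely
many `k` implies SPC4" — provers may assume `X` only for `k ≥ k₀` of their choice (e.g. in the
Dunfield–Thurston regime `g ≫ |Q|` of route CongruenceShadows). -/
theorem agkCor6Sufficiency_iff_frequently :
    AgkCor6Sufficiency ↔
      ((∀ k₀ : ℕ, ∃ k, k₀ ≤ k ∧ ∀ K : TrisectionKernels (3 * k),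
          IsGroupTrisection (3 * k) k (PUnit : Type) K → K.IsStablyTrivial) → _root_.SmoothPoincare4) := by
  rw [agkCor6Sufficiency_iff]
  constructor
  · exact fun h hf => h (agkCondition_of_frequently hf)
  · exact fun h x => h fun k₀ => ⟨k₀, le_rfl, x k₀⟩



/-! ## 8. Anatomy of a disproof (cycle 2): through the tree, `¬ crux` blames one named leaf

The crux is PROVED in the tree from three named leaves
(`spc4_of_forall_isStablyTrivial_of_three_leaves`, TrisectionFunctorSPC4Proofs.lean): Gay–Kirby
Thm. 4 (`exists_isBalancedGKTrisection`, now DISCHARGED: `exists_isBalancedGKTrisection_holds`,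
TrisectionsProofs.lean), (b′) rigidity `diffeomorph_of_iso_groupGKTrisectionOf` and (c′)
stabilisation `exists_stabilized_gkTrisection` (both open).  So a disproof of the crux is a
disproof of `(b′) ∧ (c′)` (`not_agkCor6Sufficiency_imp_not_leaves`).  Sharper: the in-tree proof
uses (b′) only against the round sphere and only for homotopy 4-spheres (`RigidityVsSphere`, the
LOAD-BEARING INSTANCE of (b′)), and that instance is itself a consequence of the summit
(`rigidityVsSphere_of_spc4`).  Hence, granted (c′), `¬ crux ↔ X ∧ ¬ RigidityVsSphere`
(`not_agkCor6Sufficiency_iff_of_stabilization`): every conjunct of a disproof is an exotic `S⁴` in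
disguise, and no junk-model refutation of the load-bearing leaf instance exists either. -/

section Anatomy

open ContinuousMap
open scoped Manifold ContDiff

/-- The round `4`-sphere of Mathlib. -/
local notation "𝕊⁴" => (Metric.sphere (0 : EuclideanSpace ℝ (Fin 5)) 1)

/-- Unpacking `¬ SmoothPoincare4`: an exotic `4`-sphere in Lean's sense (a Hausdorff second
countable `C^∞` `4`-manifold homotopy equivalent but not diffeomorphic to `𝕊⁴`). -/
theorem not_spc4_iff_exotic : ¬ _root_.SmoothPoincare4 ↔
    ∃ (M : Type) (_ : TopologicalSpace M) (_ : T2Space M) (_ : SecondCountableTopology M)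
      (_ : ChartedSpace (EuclideanSpace ℝ (Fin 4)) M) (_ : IsManifold (𝓡 4) ∞ M),
      Nonempty (M ≃ₕ 𝕊⁴) ∧ IsEmpty (M ≃ₘ⟮𝓡 4, 𝓡 4⟯ 𝕊⁴) := by
  constructor
  · intro h
    by_contra hne
    apply h
    intro M _ _ _ cs im e
    by_contra hd
    exact hne ⟨M, inferInstance, inferInstance, inferInstance, cs, im, ⟨e⟩, not_nonempty_iff.1 hd⟩
  · rintro ⟨M, _, _, _, cs, im, ⟨e⟩, hempty⟩ h
    exact not_nonempty_iff.2 hempty (h M cs im e)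

/-- `¬ crux` = AGK's condition `X` together with an exotic `4`-sphere. -/
theorem not_agkCor6Sufficiency_iff_exotic : ¬ AgkCor6Sufficiency ↔
    AgkHypothesis ∧
    ∃ (M : Type) (_ : TopologicalSpace M) (_ : T2Space M) (_ : SecondCountableTopology M)
      (_ : ChartedSpace (EuclideanSpace ℝ (Fin 4)) M) (_ : IsManifold (𝓡 4) ∞ M),
      Nonempty (M ≃ₕ 𝕊⁴) ∧ IsEmpty (M ≃ₘ⟮𝓡 4, 𝓡 4⟯ 𝕊⁴) := by
  rw [not_agkCor6Sufficiency_iff, not_spc4_iff_exotic]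

/-- **Through the tree, a disproof of the crux refutes (b′) ∧ (c′).**  Gay–Kirby Thm. 4 being
discharged (`exists_isBalancedGKTrisection_holds`), `¬ crux` contradicts the conjunction of the two
open leaves (b′) `diffeomorph_of_iso_groupGKTrisectionOf` and (c′) `exists_stabilized_gkTrisection`
(universe `0`), by `spc4_of_forall_isStablyTrivial_of_three_leaves`. -/
theorem not_agkCor6Sufficiency_imp_not_leaves (h : ¬ AgkCor6Sufficiency) :
    ¬ (diffeomorph_of_iso_groupGKTrisectionOf.{0} ∧ exists_stabilized_gkTrisection.{0}) := by
  rintro ⟨hb, hc⟩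
  rw [not_agkCor6Sufficiency_iff] at h
  exact h.2 fun M _ _ _ =>
    spc4_of_forall_isStablyTrivial_of_three_leaves exists_isBalancedGKTrisection_holds hb hc h.1 M

/-- **The load-bearing instance of (b′).**  Rigidity is used by the in-tree proof of the crux only
in this form: a closed connected oriented smooth `4`-manifold `M` HOMOTOPY EQUIVALENT TO `𝕊⁴`,
carrying a balanced Gay–Kirby trisection whose kernel triple is isomorphic to that of a balanced
trisection of the round `𝕊⁴` of the same type, is diffeomorphic to `𝕊⁴`. -/
def RigidityVsSphere : Prop :=
  ∀ (M : Type) [TopologicalSpace M] [T2Space M] [SecondCountableTopology M]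
    [ChartedSpace (EuclideanSpace ℝ (Fin 4)) M] [IsManifold (𝓡 4) ∞ M] [CompactSpace M]
    [ConnectedSpace M] (_ : SmoothOrientation (𝓡 4) M) (_ : M ≃ₕ 𝕊⁴)
    (_ : SmoothOrientation (𝓡 4) 𝕊⁴)
    (g k : ℕ) (T : Fin 3 → Set M) (S' : Fin 3 → Set 𝕊⁴)
    (hT : IsBalancedGKTrisection M g k T) (hS' : IsBalancedGKTrisection 𝕊⁴ g k S')
    (y₀ : centralSurface T) (x₀' : centralSurface S')
    (ν : SurfaceGroup g ≃* FundamentalGroup (centralSurface T) y₀)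
    (μ' : SurfaceGroup g ≃* FundamentalGroup (centralSurface S') x₀'),
    TrisectionKernels.Iso (groupGKTrisectionOf hT y₀ ν) (groupGKTrisectionOf hS' x₀' μ') →
      Nonempty (M ≃ₘ⟮𝓡 4, 𝓡 4⟯ 𝕊⁴)

/-- (b′) implies its load-bearing instance (specialisation `X' := 𝕊⁴`). -/
theorem rigidityVsSphere_of_rigidity (hb : diffeomorph_of_iso_groupGKTrisectionOf.{0}) :
    RigidityVsSphere :=
  fun M _ _ _ _ _ _ _ o _ o' g k T S' hT hS' y₀ x₀' ν μ' h =>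
    hb M o 𝕊⁴ o' g k T S' hT hS' y₀ x₀' ν μ' h

/-- **The load-bearing instance of (b′) follows from the summit** (forget the trisections). So it
admits no refutation short of an exotic `S⁴`, junk models of `IsBalancedGKTrisection` included. -/
theorem rigidityVsSphere_of_spc4 (h : _root_.SmoothPoincare4) : RigidityVsSphere :=
  fun M _ _ _ cs im _ _ _ e _ _ _ _ _ _ _ _ _ _ _ _ => h M cs im e

/-- The last step of the in-tree assembly, re-run with `RigidityVsSphere` in place of (b′): the
genus bookkeeping `cast` is eliminated by `subst`. -/
theorem nonempty_diffeomorph_sphere_of_iso_cast_vs (hR : RigidityVsSphere)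
    {M : Type} [TopologicalSpace M] [T2Space M] [SecondCountableTopology M]
    [ChartedSpace (EuclideanSpace ℝ (Fin 4)) M] [IsManifold (𝓡 4) ∞ M] [CompactSpace M]
    [ConnectedSpace M] (o : SmoothOrientation (𝓡 4) M) (e : M ≃ₕ 𝕊⁴)
    (o' : SmoothOrientation (𝓡 4) 𝕊⁴)
    {G kM : ℕ} {T : Fin 3 → Set M} (hT : IsBalancedGKTrisection M G kM T)
    (y₀ : centralSurface T) (ν : SurfaceGroup G ≃* FundamentalGroup (centralSurface T) y₀)
    {G₂ k₂ : ℕ} {S' : Fin 3 → Set 𝕊⁴} (hS' : IsBalancedGKTrisection 𝕊⁴ G₂ k₂ S')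
    (x₀' : centralSurface S')
    (μ' : SurfaceGroup G₂ ≃* FundamentalGroup (centralSurface S') x₀')
    (K₂ : TrisectionKernels G₂)
    (hK₂ : TrisectionKernels.Iso (groupGKTrisectionOf hS' x₀' μ') K₂)
    (eg : G₂ = G) (ek : k₂ = kM)
    (hIso : TrisectionKernels.Iso (groupGKTrisectionOf hT y₀ ν) (K₂.cast eg)) :
    Nonempty (M ≃ₘ⟮𝓡 4, 𝓡 4⟯ 𝕊⁴) := by
  subst eg ek
  rw [TrisectionKernels.cast_rfl] at hIso
  exact hR M o e o' _ _ T S' hT hS' y₀ x₀' ν μ' (hIso.trans hK₂.symm)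

/-- **The in-tree proof of the crux, re-run with the load-bearing instance only**: `X`, (c′) and
`RigidityVsSphere` give the summit (proof = `spc4_of_forall_isStablyTrivial_of_facts` verbatim with
its discharged leaves plugged in; the conclusion is spelled as the body of `SmoothPoincare4`). -/
theorem nonemptyDiffeomorphSphere_of_rigidityVsSphere (hR : RigidityVsSphere)
    (hc : exists_stabilized_gkTrisection.{0}) (hst : AgkHypothesis)
    (M : Type) [TopologicalSpace M] [T2Space M] [SecondCountableTopology M] :
    HomotopyEquiv.NonemptyDiffeomorphSphere M 4 := by
  intro _ _ e
  haveI : CompactSpace M := compactSpace_of_homotopyEquiv_sphere_four_holds M e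
  obtain ⟨o⟩ := isOrientable_of_homotopyEquiv_sphere_four_holds M e
  haveI : SimplyConnectedSpace 𝕊⁴ := simplyConnectedSpace_sphere_four_holds
  haveI : SimplyConnectedSpace M := e.simplyConnectedSpace
  obtain ⟨o'⟩ := isOrientable_sphere_holds 4
  obtain ⟨g, k, S, -, hS⟩ := exists_isBalancedGKTrisection_holds M o
  obtain rfl : g = 3 * k :=
    gkTrisection_genus_eq_sum_of_homotopyEquiv_sphere_holds.balanced M o hS e
  obtain ⟨x₀, ⟨μ⟩⟩ := exists_marking_centralSurface_of_gkTrisection_holds M o (3 * k) k S hS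
  have hK : IsGroupTrisection (3 * k) k (PUnit : Type) (groupGKTrisectionOf hS x₀ μ) :=
    (isGroupTrisection_groupGKTrisectionOf_holds M o (3 * k) k S hS x₀ μ).punit_of_subsingleton
  obtain ⟨n, m, hnm, hiso⟩ := hst k _ hK
  obtain ⟨Sₙ, hₙ, xₙ, μₙ, hEq⟩ := exists_gkTrisection_stabilizeIter hc M o hS x₀ μ n
  rw [← hEq] at hiso
  obtain ⟨S', hS', x', μ', hiso'⟩ := sphere_gkTrisections_of_stabilization hc m
  exact nonempty_diffeomorph_sphere_of_iso_cast_vs hR o e o' hₙ xₙ μₙ hS' x' μ' _ hiso' hnm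
    (by omega) hiso

/-- **Granted (c′), a disproof of the crux is exactly: AGK's condition `X` AND a failure of
rigidity against the round sphere for homotopy 4-spheres** — and the latter alone already
contradicts the summit (`rigidityVsSphere_of_spc4`). -/
theorem not_agkCor6Sufficiency_iff_of_stabilization (hc : exists_stabilized_gkTrisection.{0}) :
    ¬ AgkCor6Sufficiency ↔ (AgkHypothesis ∧ ¬ RigidityVsSphere) := by
  rw [not_agkCor6Sufficiency_iff]
  constructor
  · rintro ⟨hX, hns⟩
    exact ⟨hX, fun hR => hns (nonemptyDiffeomorphSphere_of_rigidityVsSphere hR hc hX)⟩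
  · rintro ⟨hX, hnR⟩
    exact ⟨hX, fun hs => hnR (rigidityVsSphere_of_spc4 hs)⟩

end Anatomy

/-! ## 9. No finite truncation of `X` is a usable hypothesis -/

section Truncation

/-- The crux with AGK's condition assumed only up to level `k₀` (by §7 this is the condition AT
`k₀`).  A formally STRONGER statement than the crux. -/
def AgkCor6SufficiencyUpTo (k₀ : ℕ) : Prop :=
  (∀ k ≤ k₀, ∀ K : TrisectionKernels (3 * k),
      IsGroupTrisection (3 * k) k (PUnit : Type) K → K.IsStablyTrivial) → _root_.SmoothPoincare4

/-- Each truncation implies the crux (recorded contrapositively). -/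
theorem not_agkCor6SufficiencyUpTo_of_not (k₀ : ℕ) (h : ¬ AgkCor6Sufficiency) :
    ¬ AgkCor6SufficiencyUpTo k₀ := fun h' =>
  h fun x => h' fun k _ K hK => x k K hK

/-- The truncations get weaker as `k₀` grows (downward closure, §7). -/
theorem agkCor6SufficiencyUpTo_mono {k₀ k₁ : ℕ} (hk : k₀ ≤ k₁) (h : AgkCor6SufficiencyUpTo k₀) :
    AgkCor6SufficiencyUpTo k₁ := fun x =>
  h fun k hk' K hK => x k (hk'.trans hk) K hK

/-- AGK's condition holds at level `0` outright (every genus-`0` triple is the trivial one, which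
is stably trivial, §4). -/
theorem agkCondition_zero (K : TrisectionKernels (3 * 0))
    (_hK : IsGroupTrisection (3 * 0) 0 (PUnit : Type) K) : K.IsStablyTrivial := by
  obtain rfl : K = trivialKernels := eq_trivialKernels K
  exact trivialKernels_isStablyTrivial

/-- **The truncation at `k₀ = 0` IS the summit**: the hypothesis `X≤0` is a theorem, so
`AgkCor6SufficiencyUpTo 0 ↔ SmoothPoincare4`.  (At `k₀ = 1` the hypothesis — every `(3,1)` group
trisection of `{1}` is stably standard, i.e. every genus-`3`-trisected homotopy `4`-sphere is
`S⁴` — is open in print: `(3;1,1,1)` is the first trisection type not covered by the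
Meier–Schirmer–Zupan classification.)  So no proof of the crux can get by with finitely many
levels of `X`, and no refutation can come from them either (§7). -/
theorem agkCor6SufficiencyUpTo_zero_iff : AgkCor6SufficiencyUpTo 0 ↔ _root_.SmoothPoincare4 := by
  constructor
  · intro h
    refine h fun k hk K hK => ?_
    obtain rfl : k = 0 := Nat.le_zero.1 hk
    exact agkCondition_zero K hK
  · exact fun h _ => h

end Truncation

/-! ## 10. Normal form of the conclusion of `X` (one existential, forced standard genus) -/

section NormalForm

/-- **Rank bookkeeping of a stable-triviality witness**: if the `n`-th stabilisation of a `(g,k)`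
trisection of `G` is isomorphic to the transported `m`-th stabilisation of `s4Kernels`, then
`k + n = 1 + m` (rank of the pairwise quotients) — so the standard side's `m` is FORCED. -/
theorem eq_of_isStablyTrivial_witness {g k : ℕ} {G : Type} [Group G] {K : TrisectionKernels g}
    (hK : IsGroupTrisection g k G K) {n m : ℕ} (h : 3 + 3 * m = g + 3 * n)
    (hiso : TrisectionKernels.Iso (K.stabilizeIter n) ((s4Kernels.stabilizeIter m).cast h)) :
    k + n = 1 + m := by
  have h₁ := isGroupTrisection_stabilizeIter hK n
  have h₂ := isGroupTrisection_cast (isGroupTrisection_s4Kernels_stabilizeIter m) h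
  obtain ⟨e⟩ := Iso.nonempty_pairQuotient_equiv hiso 0 1
  exact IsFreeOfRank.rank_unique ((h₁.free_pairQuotient 0 1 (by decide)).of_mulEquiv e)
    (h₂.free_pairQuotient 0 1 (by decide))

/-- **One-existential normal form of `IsStablyTrivial` on group trisections**: for a `(g,k)`
trisection `K` of any group, `K` is stably trivial iff for some `n` with `k + n ≥ 1` the `n`-th
stabilisation of `K` is isomorphic to the transported `(k + n - 1)`-th stabilisation of
`s4Kernels`.  (For the crux family `g = 3k` the genus side condition is automatic.) -/
theorem isStablyTrivial_iff_exists {g k : ℕ} {G : Type} [Group G] {K : TrisectionKernels g}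
    (hK : IsGroupTrisection g k G K) :
    K.IsStablyTrivial ↔ ∃ n : ℕ, 1 ≤ k + n ∧ ∃ h : 3 + 3 * (k + n - 1) = g + 3 * n,
      TrisectionKernels.Iso (K.stabilizeIter n) ((s4Kernels.stabilizeIter (k + n - 1)).cast h) := by
  constructor
  · rintro ⟨n, m, h, hiso⟩
    have hk := eq_of_isStablyTrivial_witness hK h hiso
    obtain rfl : m = k + n - 1 := by omega
    exact ⟨n, by omega, h, hiso⟩
  · rintro ⟨n, -, h, hiso⟩
    exact ⟨n, k + n - 1, h, hiso⟩

/-- In the crux family: a `(3k,k)` trisection of `{1}` is stably trivial iff some `n`-th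
stabilisation (`k + n ≥ 1`) is isomorphic to the transported `(k+n-1)`-th stabilisation of
`s4Kernels` — the shape in which route CongruenceShadows consumes `X` (`n = 0`, `m = k - 1`). -/
theorem isStablyTrivial_iff_exists_balanced {k : ℕ} {K : TrisectionKernels (3 * k)}
    (hK : IsGroupTrisection (3 * k) k (PUnit : Type) K) :
    K.IsStablyTrivial ↔ ∃ n : ℕ, 1 ≤ k + n ∧ ∃ h : 3 + 3 * (k + n - 1) = 3 * k + 3 * n,
      TrisectionKernels.Iso (K.stabilizeIter n) ((s4Kernels.stabilizeIter (k + n - 1)).cast h) :=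
  isStablyTrivial_iff_exists hK

/-- **Downward half of stabilisation-invariance of the conclusion** (the upward half,
`K.IsStablyTrivial → K.stabilize.IsStablyTrivial`, is only available in the tree for isomorphisms
witnessed by LIFTABLE automorphisms of `S_g` — `TrisectionKernels.Iso.stabilize_of_lift`,
TrisectionFunctorGKStabilization.lean — i.e. modulo Nielsen's theorem that every automorphism of
`S_g` lifts to `Aut F_{2g}`; mathematically immediate, formally a named gap provers should know). -/
theorem isStablyTrivial_of_stabilize {g : ℕ} (K : TrisectionKernels g)
    (h : K.stabilize.IsStablyTrivial) : K.IsStablyTrivial :=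
  isStablyTrivial_of_stabilizeIter K 1 h

/-- Upward half for witnesses that genuinely stabilise (`n ≥ 1`): then `K.stabilize` inherits the
SAME witness, no lifting theorem needed. -/
theorem isStablyTrivial_stabilize_of_witness {g : ℕ} (K : TrisectionKernels g) {n m : ℕ}
    (h : 3 + 3 * m = g + 3 * (1 + n))
    (hiso : TrisectionKernels.Iso (K.stabilizeIter (1 + n)) ((s4Kernels.stabilizeIter m).cast h)) :
    K.stabilize.IsStablyTrivial := by
  have q : 3 + 3 * m = g + 3 + 3 * n := by omega
  refine ⟨n, m, q, ?_⟩
  rw [show K.stabilize = K.stabilizeIter 1 from rfl, stabilizeIter_add K 1 n]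
  have p : g + 3 * (1 + n) = g + 3 + 3 * n := by omega
  rw [show (s4Kernels.stabilizeIter m).cast q = ((s4Kernels.stabilizeIter m).cast h).cast p by
    rw [cast_cast]]
  exact (iso_cast_iff p _ _).2 hiso

end NormalForm

/-! ## 11. Targets I (cycle 3) — the registered skeleton `Lines/level-set-kirby-triple.lean`

### 11.1 Necessity of the kernel condition of (HKE) / `HandlebodyExtension` -/

section KernelNecessity

open scoped Manifold ContDiff Topology ContinuousMap

variable {X X' Y Y' : Type*} [TopologicalSpace X] [TopologicalSpace X'] [TopologicalSpace Y]
  [TopologicalSpace Y']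

/-- `mapOfEq` along equal maps (with any two proofs of the base-point equation) agree. -/
theorem mapOfEq_congr_map {f g : C(X, Y)} (hfg : f = g) {x : X} {y : Y} (hf : f x = y)
    (hg : g x = y) (a : FundamentalGroup X x) :
    FundamentalGroup.mapOfEq f hf a = FundamentalGroup.mapOfEq g hg a := by
  subst hfg
  rfl

/-- **Necessity of the kernel condition (pure topology).**  For a square of continuous maps
`Φ ∘ i = i' ∘ φ` whose horizontal arrows `φ : X ≃ₜ X'`, `Φ : Y ≃ₜ Y'` are homeomorphisms,
`φ_*` carries `ker (i_* : π₁(X, x₀) → π₁(Y, i x₀))` ONTO `ker (i'_* : π₁(X', φ x₀) → π₁(Y', _))`.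
So the hypothesis of the stubs `HandlebodyKernelExtension` (line level-set-kirby-triple) and
`HandlebodyExtension` (line lp-by-sphere-system-surgery) is not only sufficient but NECESSARY
for the boundary diffeomorphism to extend: those stubs are `iff`s and cannot be weakened. -/
theorem map_ker_eq_ker_of_semiconj (i : C(X, Y)) (i' : C(X', Y')) (φ : X ≃ₜ X') (Φ : Y ≃ₜ Y')
    (h : ∀ x, Φ (i x) = i' (φ x)) (x₀ : X) :
    ((FundamentalGroup.map i x₀).ker).map (FundamentalGroup.map (φ : C(X, X')) x₀) =
      (FundamentalGroup.map i' (φ x₀)).ker := by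
  have hcomp : i'.comp (φ : C(X, X')) = (Φ : C(Y, Y')).comp i :=
    ContinuousMap.ext fun x => (h x).symm
  have hx₀ : ((Φ : C(Y, Y')).comp i) x₀ = i' (φ x₀) := h x₀
  ext δ
  simp only [Subgroup.mem_map, MonoidHom.mem_ker, FundamentalGroup.map_eq_mapOfEq]
  constructor
  · rintro ⟨γ, hγ, rfl⟩
    rw [← FundamentalGroup.mapOfEq_comp_apply (φ : C(X, X')) i' rfl rfl γ,
      mapOfEq_congr_map hcomp _ hx₀,
      FundamentalGroup.mapOfEq_comp_apply i (Φ : C(Y, Y')) rfl (h x₀) γ, hγ, map_one]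
  · intro hδ
    refine ⟨FundamentalGroup.mapOfEq (φ.symm : C(X', X)) (φ.symm_apply_apply x₀) δ, ?_, ?_⟩
    · apply (Homeomorph.fundamentalGroupCongr Φ (h x₀)).injective
      rw [map_one, Homeomorph.fundamentalGroupCongr_apply,
        ← FundamentalGroup.mapOfEq_comp_apply i (Φ : C(Y, Y')) rfl (h x₀),
        mapOfEq_congr_map hcomp.symm _ (show (i'.comp (φ : C(X, X'))) x₀ = i' (φ x₀) from rfl),
        FundamentalGroup.mapOfEq_comp_apply (φ : C(X, X')) i' rfl rfl,
        ← FundamentalGroup.mapOfEq_comp_apply (φ.symm : C(X', X)) (φ : C(X, X'))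
          (φ.symm_apply_apply x₀) rfl δ,
        FundamentalGroup.mapOfEq_apply_eq_self_of_forall_eq
          ((φ : C(X, X')).comp (φ.symm : C(X', X))) (fun p => φ.apply_symm_apply p) δ]
      exact hδ
    · rw [← FundamentalGroup.mapOfEq_comp_apply (φ.symm : C(X', X)) (φ : C(X, X'))
          (φ.symm_apply_apply x₀) rfl δ]
      exact FundamentalGroup.mapOfEq_apply_eq_self_of_forall_eq
        ((φ : C(X, X')).comp (φ.symm : C(X', X))) (fun p => φ.apply_symm_apply p) δ

/-- **Manifold form, exactly the shape of the stubs**: if a diffeomorphism `Φ : H ≅ H'` extends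
the boundary diffeomorphism `φ` (`Φ ∘ incl = incl' ∘ φ`), then `φ_*` maps
`ker (π₁ ∂H → π₁ H)` onto `ker (π₁ ∂H' → π₁ H')`. -/
theorem map_ker_eq_ker_of_extends {H H' : Type*} [TopologicalSpace H]
    [ChartedSpace (EuclideanHalfSpace 3) H] [TopologicalSpace H']
    [ChartedSpace (EuclideanHalfSpace 3) H']
    (b : BoundaryData (𝓡∂ 3) H (𝓡 2)) (b' : BoundaryData (𝓡∂ 3) H' (𝓡 2))
    (φ : b.carrier ≃ₘ⟮𝓡 2, 𝓡 2⟯ b'.carrier) (Φ : H ≃ₘ⟮𝓡∂ 3, 𝓡∂ 3⟯ H')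
    (hΦ : ⇑Φ ∘ b.incl = b'.incl ∘ ⇑φ) (x₀ : b.carrier) :
    ((FundamentalGroup.map (⟨b.incl, b.continuous_incl⟩ : C(b.carrier, H)) x₀).ker).map
        (FundamentalGroup.map (⟨φ, φ.continuous⟩ : C(b.carrier, b'.carrier)) x₀)
      = (FundamentalGroup.map (⟨b'.incl, b'.continuous_incl⟩ : C(b'.carrier, H'))
          ((⟨φ, φ.continuous⟩ : C(b.carrier, b'.carrier)) x₀)).ker :=
  map_ker_eq_ker_of_semiconj ⟨b.incl, b.continuous_incl⟩ ⟨b'.incl, b'.continuous_incl⟩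
    φ.toHomeomorph Φ.toHomeomorph (fun x => congrFun hΦ x) x₀

end KernelNecessity




/-! ### 11.2 The statements of the registered skeleton (verbatim copies, skeleton sha `ea27592aaaf5`)

The module `Lines/level-set-kirby-triple.lean` is not built (no `.olean`), so its statements are
re-declared here word for word, inside the sub-namespace `LevelSetKirbyTriple`, to let this work
file state kernel-checked facts ABOUT them. -/

namespace LevelSetKirbyTriple

open Set
open scoped Manifold ContDiff Topology ContinuousMap

/-- Verbatim copy of the skeleton's `LevelDatum`. -/
structure LevelDatum (M : Type) [TopologicalSpace M] [T2Space M] [SecondCountableTopology M]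
    [CompactSpace M] [ChartedSpace (EuclideanSpace ℝ (Fin 4)) M] [IsManifold (𝓡 4) ∞ M]
    (g : ℕ) (κ : Fin 3 → ℕ) where
  B : BiCollar M
  T : B.TriData
  isGKTrisection : IsGKTrisection M g κ T.sectors
  morseIndex_le_two_of_lt_top :
    ∀ p, IsMCriticalPt (𝓡 4) B.f p → B.f p < T.c → morseIndex (𝓡 4) B.f p ≤ 2
  ncard_top_of_le_two :
    ∀ i, i ≤ 2 → (criticalSetOfIndex (𝓡 4) B.f i ∩ B.f ⁻¹' Set.Ioi T.c).ncard = 0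
  ncard_top_three : (criticalSetOfIndex (𝓡 4) B.f 3 ∩ B.f ⁻¹' Set.Ioi T.c).ncard = κ 2
  ncard_top_four : (criticalSetOfIndex (𝓡 4) B.f 4 ∩ B.f ⁻¹' Set.Ioi T.c).ncard = 1

namespace LevelDatum

variable {M : Type} [TopologicalSpace M] [T2Space M] [SecondCountableTopology M]
  [CompactSpace M] [ChartedSpace (EuclideanSpace ℝ (Fin 4)) M] [IsManifold (𝓡 4) ∞ M]
  {g : ℕ} {κ : Fin 3 → ℕ}

/-- Verbatim copy: the Kirby triple of a level datum. -/
noncomputable def kernels (d : LevelDatum M g κ) (x₀ : centralSurface d.T.sectors)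
    (μ : SurfaceGroup g ≃* FundamentalGroup (centralSurface d.T.sectors) x₀) :
    TrisectionKernels g :=
  groupGKTrisectionOf d.isGKTrisection x₀ μ

/-- Verbatim copy: re-marking. -/
theorem exists_marking_eq (d : LevelDatum M g κ) (x₀ : centralSurface d.T.sectors)
    (μ : SurfaceGroup g ≃* FundamentalGroup (centralSurface d.T.sectors) x₀)
    {K : TrisectionKernels g} (h : TrisectionKernels.Iso (d.kernels x₀ μ) K) :
    ∃ μ' : SurfaceGroup g ≃* FundamentalGroup (centralSurface d.T.sectors) x₀, d.kernels x₀ μ' = K :=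
  exists_marking_groupGKTrisectionOf_eq d.isGKTrisection x₀ μ h

/-- Verbatim copy: the top level is regular. -/
theorem regularTop (d : LevelDatum M g κ) : IsRegularLevel (𝓡 4) d.B.f d.T.c :=
  ⟨d.T.Fr.isMorse.contMDiff, fun _ _ => BoundarylessManifold.isInteriorPoint,
    fun x hx => d.T.regular_c x hx⟩

/-- Verbatim copy: the `2`-handlebody `{f ≤ c}`. -/
abbrev TwoHandlebody (d : LevelDatum M g κ) : Type := RegularSublevel d.regularTop

end LevelDatum

/-- Verbatim copy of stub statement (E₀). -/
def LevelDatumExists : Prop :=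
  ∀ (M : Type) [TopologicalSpace M] [T2Space M] [SecondCountableTopology M] [CompactSpace M]
    [ChartedSpace (EuclideanSpace ℝ (Fin 4)) M] [IsManifold (𝓡 4) ∞ M] [ConnectedSpace M],
    ∃ (g : ℕ) (κ : Fin 3 → ℕ), Nonempty (LevelDatum M g κ)

/-- Verbatim copy of stub statement (S). -/
def LevelStabilizeOne : Prop :=
  ∀ (M : Type) [TopologicalSpace M] [T2Space M] [SecondCountableTopology M] [CompactSpace M]
    [ChartedSpace (EuclideanSpace ℝ (Fin 4)) M] [IsManifold (𝓡 4) ∞ M] [ConnectedSpace M]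
    (_ : SmoothOrientation (𝓡 4) M) (g : ℕ) (κ : Fin 3 → ℕ) (d : LevelDatum M g κ) (i : Fin 3),
    ∃ d' : LevelDatum M (g + 1) (Function.update κ i (κ i + 1)),
      ∀ (x₀ : centralSurface d.T.sectors)
        (μ : SurfaceGroup g ≃* FundamentalGroup (centralSurface d.T.sectors) x₀),
        ∃ (x₀' : centralSurface d'.T.sectors)
          (μ' : SurfaceGroup (g + 1) ≃* FundamentalGroup (centralSurface d'.T.sectors) x₀'),
          TrisectionKernels.Iso (d'.kernels x₀' μ') ((d.kernels x₀ μ).stabilizeOne i)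

/-- Verbatim copy of stub statement (HKE). -/
def HandlebodyKernelExtension : Prop :=
  ∀ (g : ℕ) (H : Type) [TopologicalSpace H] [T2Space H] [SecondCountableTopology H]
    [ChartedSpace (EuclideanHalfSpace 3) H] [IsManifold (𝓡∂ 3) ∞ H]
    (H' : Type) [TopologicalSpace H'] [T2Space H'] [SecondCountableTopology H']
    [ChartedSpace (EuclideanHalfSpace 3) H'] [IsManifold (𝓡∂ 3) ∞ H']
    (_ : IsHandlebody g H) (_ : IsHandlebody g H')
    (b : BoundaryData (𝓡∂ 3) H (𝓡 2)) (b' : BoundaryData (𝓡∂ 3) H' (𝓡 2))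
    (φ : b.carrier ≃ₘ⟮𝓡 2, 𝓡 2⟯ b'.carrier) (x₀ : b.carrier),
    ((FundamentalGroup.map (⟨b.incl, b.continuous_incl⟩ : C(b.carrier, H)) x₀).ker).map
        (FundamentalGroup.map (⟨φ, φ.continuous⟩ : C(b.carrier, b'.carrier)) x₀)
      = (FundamentalGroup.map (⟨b'.incl, b'.continuous_incl⟩ : C(b'.carrier, H'))
          ((⟨φ, φ.continuous⟩ : C(b.carrier, b'.carrier)) x₀)).ker →
    ∃ Φ : H ≃ₘ⟮𝓡∂ 3, 𝓡∂ 3⟯ H', ⇑Φ ∘ b.incl = b'.incl ∘ ⇑φ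

/-- Verbatim copy of stub statement (R1). -/
def TwoHandlebodyRecognition : Prop :=
  ∀ (M : Type) [TopologicalSpace M] [T2Space M] [SecondCountableTopology M] [CompactSpace M]
    [ChartedSpace (EuclideanSpace ℝ (Fin 4)) M] [IsManifold (𝓡 4) ∞ M] [ConnectedSpace M]
    (_ : SmoothOrientation (𝓡 4) M)
    (M' : Type) [TopologicalSpace M'] [T2Space M'] [SecondCountableTopology M'] [CompactSpace M']
    [ChartedSpace (EuclideanSpace ℝ (Fin 4)) M'] [IsManifold (𝓡 4) ∞ M'] [ConnectedSpace M']
    (_ : SmoothOrientation (𝓡 4) M')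
    (g : ℕ) (κ : Fin 3 → ℕ) (d : LevelDatum M g κ) (d' : LevelDatum M' g κ)
    (x₀ : centralSurface d.T.sectors) (μ : SurfaceGroup g ≃* FundamentalGroup (centralSurface d.T.sectors) x₀)
    (x₀' : centralSurface d'.T.sectors) (μ' : SurfaceGroup g ≃* FundamentalGroup (centralSurface d'.T.sectors) x₀'),
    TrisectionKernels.Iso (d.kernels x₀ μ) (d'.kernels x₀' μ') →
      Nonempty (d.TwoHandlebody ≃ₘ⟮𝓡∂ 4, 𝓡∂ 4⟯ d'.TwoHandlebody)

/-- Verbatim copy of stub statement (R2). -/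
def TwoHandlebodyReassembly : Prop :=
  ∀ (M : Type) [TopologicalSpace M] [T2Space M] [SecondCountableTopology M] [CompactSpace M]
    [ChartedSpace (EuclideanSpace ℝ (Fin 4)) M] [IsManifold (𝓡 4) ∞ M] [ConnectedSpace M]
    (_ : SmoothOrientation (𝓡 4) M)
    (M' : Type) [TopologicalSpace M'] [T2Space M'] [SecondCountableTopology M'] [CompactSpace M']
    [ChartedSpace (EuclideanSpace ℝ (Fin 4)) M'] [IsManifold (𝓡 4) ∞ M'] [ConnectedSpace M']
    (_ : SmoothOrientation (𝓡 4) M')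
    (g : ℕ) (κ : Fin 3 → ℕ) (d : LevelDatum M g κ) (d' : LevelDatum M' g κ),
    Nonempty (d.TwoHandlebody ≃ₘ⟮𝓡∂ 4, 𝓡∂ 4⟯ d'.TwoHandlebody) → Nonempty (M ≃ₘ⟮𝓡 4, 𝓡 4⟯ M')

end LevelSetKirbyTriple

/-! ### 11.3 The load-bearing instance of (R1, R2) follows from the summit; 11.4 the hidden cost of (S) -/

section LevelLine

open Set ContinuousMap LevelSetKirbyTriple
open scoped Manifold ContDiff Topology

local notation "𝕊⁴" => (Metric.sphere (0 : EuclideanSpace ℝ (Fin 5)) 1)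

/-- **HKE is an `iff`** (granted the stub): a boundary diffeomorphism of genus-`g` handlebodies
extends if and only if it carries kernel onto kernel. -/
theorem extends_iff_kernel (hHKE : HandlebodyKernelExtension) (g : ℕ)
    (H : Type) [TopologicalSpace H] [T2Space H] [SecondCountableTopology H]
    [ChartedSpace (EuclideanHalfSpace 3) H] [IsManifold (𝓡∂ 3) ∞ H]
    (H' : Type) [TopologicalSpace H'] [T2Space H'] [SecondCountableTopology H']
    [ChartedSpace (EuclideanHalfSpace 3) H'] [IsManifold (𝓡∂ 3) ∞ H']
    (hH : IsHandlebody g H) (hH' : IsHandlebody g H')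
    (b : BoundaryData (𝓡∂ 3) H (𝓡 2)) (b' : BoundaryData (𝓡∂ 3) H' (𝓡 2))
    (φ : b.carrier ≃ₘ⟮𝓡 2, 𝓡 2⟯ b'.carrier) (x₀ : b.carrier) :
    (∃ Φ : H ≃ₘ⟮𝓡∂ 3, 𝓡∂ 3⟯ H', ⇑Φ ∘ b.incl = b'.incl ∘ ⇑φ) ↔
      ((FundamentalGroup.map (⟨b.incl, b.continuous_incl⟩ : C(b.carrier, H)) x₀).ker).map
          (FundamentalGroup.map (⟨φ, φ.continuous⟩ : C(b.carrier, b'.carrier)) x₀)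
        = (FundamentalGroup.map (⟨b'.incl, b'.continuous_incl⟩ : C(b'.carrier, H'))
            ((⟨φ, φ.continuous⟩ : C(b.carrier, b'.carrier)) x₀)).ker :=
  ⟨fun ⟨Φ, hΦ⟩ => map_ker_eq_ker_of_extends b b' φ Φ hΦ x₀,
    fun h => hHKE g H H' hH hH' b b' φ x₀ h⟩

/-- **The load-bearing instance of (R1, R2)**: recognition followed by reassembly is consumed by
the skeleton's composition `AgkCor6Sufficiency_of` ONLY for `M` a homotopy `4`-sphere against
`M' = 𝕊⁴` (level data of the same type with isomorphic Kirby triples). -/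
def LevelRigidityVsSphere : Prop :=
  ∀ (M : Type) [TopologicalSpace M] [T2Space M] [SecondCountableTopology M] [CompactSpace M]
    [ChartedSpace (EuclideanSpace ℝ (Fin 4)) M] [IsManifold (𝓡 4) ∞ M] [ConnectedSpace M]
    (_ : SmoothOrientation (𝓡 4) M) (_ : M ≃ₕ 𝕊⁴) (_ : SmoothOrientation (𝓡 4) 𝕊⁴)
    (g : ℕ) (κ : Fin 3 → ℕ) (d : LevelDatum M g κ) (d' : LevelDatum 𝕊⁴ g κ)
    (x₀ : centralSurface d.T.sectors)
    (μ : SurfaceGroup g ≃* FundamentalGroup (centralSurface d.T.sectors) x₀)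
    (x₀' : centralSurface d'.T.sectors)
    (μ' : SurfaceGroup g ≃* FundamentalGroup (centralSurface d'.T.sectors) x₀'),
    TrisectionKernels.Iso (d.kernels x₀ μ) (d'.kernels x₀' μ') → Nonempty (M ≃ₘ⟮𝓡 4, 𝓡 4⟯ 𝕊⁴)

/-- (R1) and (R2) imply their load-bearing instance. -/
theorem levelRigidityVsSphere_of_stubs (hRec : TwoHandlebodyRecognition)
    (hAsm : TwoHandlebodyReassembly) : LevelRigidityVsSphere :=
  fun M _ _ _ _ _ _ _ o _ o' g κ d d' x₀ μ x₀' μ' h =>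
    hAsm M o 𝕊⁴ o' g κ d d' (hRec M o 𝕊⁴ o' g κ d d' x₀ μ x₀' μ' h)

/-- **The load-bearing instance follows from the summit** (forget all the data): so no junk
level datum, and no failure of DNB / HKE / LP *beyond what SPC4 itself forbids*, can refute the
instance of (R1, R2) that the line needs. -/
theorem levelRigidityVsSphere_of_spc4 (h : _root_.SmoothPoincare4) : LevelRigidityVsSphere :=
  fun M _ _ _ _ cs im _ _ e _ _ _ _ _ _ _ _ _ _ => h M cs im e

variable {M : Type} [TopologicalSpace M] [T2Space M] [SecondCountableTopology M]
  [CompactSpace M] [ChartedSpace (EuclideanSpace ℝ (Fin 4)) M] [IsManifold (𝓡 4) ∞ M]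

/-- **Hidden cost of stub (S), kernel-checked: (S) contains the `Iso`-invariance of the
unbalanced stabilisation on every kernel triple realised by a level datum.**  Because (S)
provides ONE new datum `d'` serving ALL based markings of `d`, and any two Kirby triples of `d'`
are isomorphic (`groupGKTrisectionOf_iso`: change of base point and marking), two markings
`(x₀, μ₀)`, `(x₁, μ₁)` of `d` have `Iso`-morphic stabilised triples.  With re-marking
(`exists_marking_eq`) this is `Iso K K' → Iso (K.stabilizeOne i) (K'.stabilizeOne i)` for every
realised `K` — the algebraic shadow of Dehn–Nielsen–Baer / Nielsen–Zieschang lifting (every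
automorphism of `S_g`, orientation-reversing ones included, extends over the new handle
preserving `⟪a_{g+1}⟫`, `⟪b_{g+1}⟫`), i.e. exactly the §10 tree gap
(`TrisectionKernels.Iso.stabilize_of_lift` is only for liftable automorphisms).  So the line does
NOT avoid Nielsen lifting: it is inside (S), whose prover must handle arbitrary markings (the
tree's on-the-nose theorem `exists_marking_groupGKTrisectionOf_eq_stabilizeOne_datum` requires
the marking to factor through a free basis `θA` of `π₁(F ∖ D)` with `θA(r_g) = t`). -/
theorem iso_stabilizeOne_of_levelStabilizeOne (hS : LevelStabilizeOne)
    {M : Type} [TopologicalSpace M] [T2Space M] [SecondCountableTopology M] [CompactSpace M]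
    [ChartedSpace (EuclideanSpace ℝ (Fin 4)) M] [IsManifold (𝓡 4) ∞ M] [ConnectedSpace M]
    (o : SmoothOrientation (𝓡 4) M) {g : ℕ} {κ : Fin 3 → ℕ} (d : LevelDatum M g κ)
    (x₀ x₁ : centralSurface d.T.sectors)
    (μ₀ : SurfaceGroup g ≃* FundamentalGroup (centralSurface d.T.sectors) x₀)
    (μ₁ : SurfaceGroup g ≃* FundamentalGroup (centralSurface d.T.sectors) x₁) (i : Fin 3) :
    TrisectionKernels.Iso ((d.kernels x₀ μ₀).stabilizeOne i) ((d.kernels x₁ μ₁).stabilizeOne i) := by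
  obtain ⟨d', h'⟩ := hS M o g κ d i
  obtain ⟨y₀, ν₀, iso₀⟩ := h' x₀ μ₀
  obtain ⟨y₁, ν₁, iso₁⟩ := h' x₁ μ₁
  have hd' : TrisectionKernels.Iso (d'.kernels y₀ ν₀) (d'.kernels y₁ ν₁) :=
    groupGKTrisectionOf_iso d'.isGKTrisection d'.isGKTrisection y₀ y₁ ν₀ ν₁
  exact iso₀.symm.trans (hd'.trans iso₁)

/-- (S) ⟹ `Iso` pushes through `stabilizeOne` for realised triples: any `K'` isomorphic to a
Kirby triple `K` of a level datum has `K'.stabilizeOne i ≅ K.stabilizeOne i`. -/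
theorem iso_stabilizeOne_of_iso_of_levelStabilizeOne (hS : LevelStabilizeOne)
    {M : Type} [TopologicalSpace M] [T2Space M] [SecondCountableTopology M] [CompactSpace M]
    [ChartedSpace (EuclideanSpace ℝ (Fin 4)) M] [IsManifold (𝓡 4) ∞ M] [ConnectedSpace M]
    (o : SmoothOrientation (𝓡 4) M) {g : ℕ} {κ : Fin 3 → ℕ} (d : LevelDatum M g κ)
    (x₀ : centralSurface d.T.sectors)
    (μ₀ : SurfaceGroup g ≃* FundamentalGroup (centralSurface d.T.sectors) x₀)
    {K' : TrisectionKernels g} (h : TrisectionKernels.Iso (d.kernels x₀ μ₀) K') (i : Fin 3) :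
    TrisectionKernels.Iso ((d.kernels x₀ μ₀).stabilizeOne i) (K'.stabilizeOne i) := by
  obtain ⟨μ', rfl⟩ := d.exists_marking_eq x₀ μ₀ h
  exact iso_stabilizeOne_of_levelStabilizeOne hS o d x₀ x₀ μ₀ μ' i

/-- (S) ⟹ twisting the marking by ANY automorphism `α` of `S_g` (orientation-reversing ones
included) does not change the stabilised triple up to `Iso`. -/
theorem iso_stabilizeOne_twist_of_levelStabilizeOne (hS : LevelStabilizeOne)
    {M : Type} [TopologicalSpace M] [T2Space M] [SecondCountableTopology M] [CompactSpace M]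
    [ChartedSpace (EuclideanSpace ℝ (Fin 4)) M] [IsManifold (𝓡 4) ∞ M] [ConnectedSpace M]
    (o : SmoothOrientation (𝓡 4) M) {g : ℕ} {κ : Fin 3 → ℕ} (d : LevelDatum M g κ)
    (x₀ : centralSurface d.T.sectors)
    (μ₀ : SurfaceGroup g ≃* FundamentalGroup (centralSurface d.T.sectors) x₀)
    (α : SurfaceGroup g ≃* SurfaceGroup g) (i : Fin 3) :
    TrisectionKernels.Iso ((d.kernels x₀ (α.trans μ₀)).stabilizeOne i)
      ((d.kernels x₀ μ₀).stabilizeOne i) :=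
  iso_stabilizeOne_of_levelStabilizeOne hS o d x₀ x₀ (α.trans μ₀) μ₀ i

/-- Copy of the skeleton's `exists_levelDatum_balanced`. -/
theorem exists_levelDatum_balanced (hE : LevelDatumExists) (hS : LevelStabilizeOne)
    [ConnectedSpace M] (o : SmoothOrientation (𝓡 4) M) :
    ∃ g k : ℕ, Nonempty (LevelDatum M g (fun _ => k)) := by
  obtain ⟨g, κ, ⟨d⟩⟩ := hE M
  have hstab : ∀ (g : ℕ) (κ : Fin 3 → ℕ) (i : Fin 3), Nonempty (LevelDatum M g κ) →
      Nonempty (LevelDatum M (g + 1) (Function.update κ i (κ i + 1))) := by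
    rintro g κ i ⟨d⟩
    obtain ⟨d', -⟩ := hS M o g κ d i
    exact ⟨d'⟩
  obtain ⟨g', k', -, h⟩ :=
    TrisectionBalancing.exists_balanced_of_stabilize (P := fun g κ => Nonempty (LevelDatum M g κ))
      hstab ⟨d⟩
  exact ⟨g', k', h⟩

/-- Copy of the skeleton's `exists_levelDatum_stabilize`. -/
theorem exists_levelDatum_stabilize (hS : LevelStabilizeOne) [ConnectedSpace M]
    (o : SmoothOrientation (𝓡 4) M) {g k : ℕ} (d : LevelDatum M g (fun _ => k))
    (x₀ : centralSurface d.T.sectors)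
    (μ : SurfaceGroup g ≃* FundamentalGroup (centralSurface d.T.sectors) x₀) :
    ∃ (d' : LevelDatum M (g + 3) (fun _ => k + 1)) (x₀' : centralSurface d'.T.sectors)
      (μ' : SurfaceGroup (g + 3) ≃* FundamentalGroup (centralSurface d'.T.sectors) x₀'),
      d'.kernels x₀' μ' = (d.kernels x₀ μ).stabilize := by
  obtain ⟨d₁, h₁⟩ := hS M o g _ d 2
  obtain ⟨x₁, μ₁, iso₁⟩ := h₁ x₀ μ
  obtain ⟨ν₁, hν₁⟩ := d₁.exists_marking_eq x₁ μ₁ iso₁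
  obtain ⟨d₂, h₂⟩ := hS M o (g + 1) _ d₁ 1
  obtain ⟨x₂, μ₂, iso₂⟩ := h₂ x₁ ν₁
  rw [hν₁] at iso₂
  obtain ⟨ν₂, hν₂⟩ := d₂.exists_marking_eq x₂ μ₂ iso₂
  obtain ⟨d₃, h₃⟩ := hS M o (g + 1 + 1) _ d₂ 0
  obtain ⟨x₃, μ₃, iso₃⟩ := h₃ x₂ ν₂
  rw [hν₂] at iso₃
  obtain ⟨ν₃, hν₃⟩ := d₃.exists_marking_eq x₃ μ₃ iso₃
  have key : ∀ (κ₃ : Fin 3 → ℕ), κ₃ = (fun _ => k + 1) →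
      ∀ (d₃ : LevelDatum M (g + 3) κ₃) (x₃ : centralSurface d₃.T.sectors)
        (ν₃ : SurfaceGroup (g + 3) ≃* FundamentalGroup (centralSurface d₃.T.sectors) x₃),
        d₃.kernels x₃ ν₃ = (d.kernels x₀ μ).stabilize →
        ∃ (d' : LevelDatum M (g + 3) (fun _ => k + 1)) (x₀' : centralSurface d'.T.sectors)
          (μ' : SurfaceGroup (g + 3) ≃* FundamentalGroup (centralSurface d'.T.sectors) x₀'),
          d'.kernels x₀' μ' = (d.kernels x₀ μ).stabilize := by
    rintro κ₃ rfl d₃ x₃ ν₃ h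
    exact ⟨d₃, x₃, ν₃, h⟩
  refine key _ ?_ d₃ x₃ ν₃ ?_
  · funext i
    fin_cases i <;> simp
  · rw [TrisectionKernels.stabilize_eq_stabilizeOne]
    exact hν₃

/-- Copy of the skeleton's `exists_levelDatum_stabilizeIter`. -/
theorem exists_levelDatum_stabilizeIter (hS : LevelStabilizeOne) [ConnectedSpace M]
    (o : SmoothOrientation (𝓡 4) M) {g k : ℕ} (d : LevelDatum M g (fun _ => k))
    (x₀ : centralSurface d.T.sectors)
    (μ : SurfaceGroup g ≃* FundamentalGroup (centralSurface d.T.sectors) x₀) (n : ℕ) :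
    ∃ (d' : LevelDatum M (g + 3 * n) (fun _ => k + n)) (x₀' : centralSurface d'.T.sectors)
      (μ' : SurfaceGroup (g + 3 * n) ≃* FundamentalGroup (centralSurface d'.T.sectors) x₀'),
      d'.kernels x₀' μ' = (d.kernels x₀ μ).stabilizeIter n := by
  induction n with
  | zero => exact ⟨d, x₀, μ, rfl⟩
  | succ n ih =>
    obtain ⟨dₙ, xₙ, μₙ, hₙ⟩ := ih
    obtain ⟨d', x', μ', h'⟩ := exists_levelDatum_stabilize hS o dₙ xₙ μₙ
    refine ⟨d', x', μ', ?_⟩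
    show d'.kernels x' μ' = ((d.kernels x₀ μ).stabilizeIter n).stabilize
    rw [h', hₙ]

/-- The skeleton's last step re-run with the load-bearing instance in place of (R1, R2). -/
theorem nonempty_diffeomorph_sphere_of_iso_cast_level (hLR : LevelRigidityVsSphere)
    [ConnectedSpace M] (o : SmoothOrientation (𝓡 4) M) (e : M ≃ₕ 𝕊⁴)
    (o' : SmoothOrientation (𝓡 4) 𝕊⁴) {g g' : ℕ} {κ κ' : Fin 3 → ℕ} (hg : g = g') (hκ : κ = κ')
    (d : LevelDatum M g κ) (d' : LevelDatum 𝕊⁴ g' κ')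
    (x₀ : centralSurface d.T.sectors) (μ : SurfaceGroup g ≃* FundamentalGroup (centralSurface d.T.sectors) x₀)
    (x₀' : centralSurface d'.T.sectors) (μ' : SurfaceGroup g' ≃* FundamentalGroup (centralSurface d'.T.sectors) x₀')
    (h : TrisectionKernels.Iso ((d.kernels x₀ μ).cast hg) (d'.kernels x₀' μ')) :
    Nonempty (M ≃ₘ⟮𝓡 4, 𝓡 4⟯ 𝕊⁴) := by
  subst hg
  subst hκ
  rw [TrisectionKernels.cast_rfl] at h
  exact hLR M o e o' g κ d d' x₀ μ x₀' μ' h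

omit [CompactSpace M] [ChartedSpace (EuclideanSpace ℝ (Fin 4)) M] [IsManifold (𝓡 4) ∞ M] in
/-- **The skeleton's composition re-run with the load-bearing instance only**: (E₀), (S),
`LevelRigidityVsSphere` and `X` give the summit (proof = the skeleton's `AgkCor6Sufficiency_of`
verbatim, `hRec`/`hAsm` replaced by `hLR`).  So DNB, HKE, LP, (R1), (R2) enter the line only
through `LevelRigidityVsSphere`. -/
theorem nonemptyDiffeomorphSphere_of_levelLine (hE : LevelDatumExists) (hS : LevelStabilizeOne)
    (hLR : LevelRigidityVsSphere) (hX : AgkHypothesis)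
    (M : Type) [TopologicalSpace M] [T2Space M] [SecondCountableTopology M] :
    HomotopyEquiv.NonemptyDiffeomorphSphere M 4 := by
  intro _ _ e
  haveI : CompactSpace M := compactSpace_of_homotopyEquiv_sphere_four_holds M e
  obtain ⟨o⟩ := isOrientable_of_homotopyEquiv_sphere_four_holds M e
  haveI : SimplyConnectedSpace 𝕊⁴ := simplyConnectedSpace_sphere_four_holds
  haveI : SimplyConnectedSpace M := e.simplyConnectedSpace
  obtain ⟨o'⟩ := isOrientable_sphere_holds 4
  obtain ⟨G, k, ⟨d₀⟩⟩ := exists_levelDatum_balanced hE hS o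
  obtain ⟨G', k', ⟨e₀⟩⟩ := exists_levelDatum_balanced hE hS o'
  obtain rfl : G = 3 * k :=
    gkTrisection_genus_eq_sum_of_homotopyEquiv_sphere_holds.balanced M o d₀.isGKTrisection e
  obtain rfl : G' = 3 * k' :=
    gkTrisection_genus_eq_sum_of_homotopyEquiv_sphere_holds.balanced 𝕊⁴ o' e₀.isGKTrisection
      (ContinuousMap.HomotopyEquiv.refl 𝕊⁴)
  obtain ⟨x₀, ⟨μ⟩⟩ :=
    exists_marking_centralSurface_of_gkTrisection_holds M o (3 * k) k d₀.T.sectors d₀.isGKTrisection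
  obtain ⟨y₀, ⟨ν⟩⟩ :=
    exists_marking_centralSurface_of_gkTrisection_holds 𝕊⁴ o' (3 * k') k' e₀.T.sectors e₀.isGKTrisection
  have hK' : IsGroupTrisection (3 * k') k' (PUnit : Type) (e₀.kernels y₀ ν) :=
    (isGroupTrisection_groupGKTrisectionOf_holds 𝕊⁴ o' (3 * k') k' e₀.T.sectors e₀.isGKTrisection
      y₀ ν).punit_of_subsingleton
  obtain ⟨n', m₀, e', iso'⟩ := hX k' _ hK'
  obtain ⟨d₁, x₁, μ₁, -⟩ := exists_levelDatum_stabilizeIter hS o d₀ x₀ μ (m₀ + 1)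
  have hK₁ : IsGroupTrisection (3 * k + 3 * (m₀ + 1)) (k + (m₀ + 1)) (PUnit : Type)
      (d₁.kernels x₁ μ₁) :=
    (isGroupTrisection_groupGKTrisectionOf_holds M o _ _ d₁.T.sectors d₁.isGKTrisection
      x₁ μ₁).punit_of_subsingleton
  have eg : 3 * k + 3 * (m₀ + 1) = 3 * (k + (m₀ + 1)) := by ring
  have hst := hX (k + (m₀ + 1)) _ (isGroupTrisection_cast hK₁ eg)
  rw [isStablyTrivial_cast_iff] at hst
  obtain ⟨n, m, hnm, iso⟩ := hst
  obtain ⟨dM, xM, μM, hdM⟩ := exists_levelDatum_stabilizeIter hS o d₁ x₁ μ₁ n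
  obtain ⟨e₁, y₁, ν₁, he₁⟩ := exists_levelDatum_stabilizeIter hS o' e₀ y₀ ν n'
  rw [← he₁] at iso'
  obtain ⟨ν₁', hν₁'⟩ := e₁.exists_marking_eq y₁ ν₁ iso'
  obtain ⟨t, rfl⟩ : ∃ t, m = m₀ + t := ⟨m - m₀, by omega⟩
  obtain ⟨eS, yS, νS, heS⟩ := exists_levelDatum_stabilizeIter hS o' e₁ y₁ ν₁' t
  rw [hν₁', stabilizeIter_cast, stabilizeIter_add, cast_cast] at heS
  have hg : 3 * k + 3 * (m₀ + 1) + 3 * n = 3 * k' + 3 * n' + 3 * t := by omega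
  have hκ : (fun _ : Fin 3 => k + (m₀ + 1) + n) = fun _ => k' + n' + t := by
    funext
    omega
  refine nonempty_diffeomorph_sphere_of_iso_cast_level hLR o e o' hg hκ dM eS xM μM yS νS ?_
  have hiso := (iso_cast_iff hg _ _).2 iso
  rw [cast_cast] at hiso
  rw [hdM, heS]
  exact hiso

/-- **Granted (E₀) and (S), a disproof of the crux along this line is exactly `X` AND a failure
of the load-bearing instance `LevelRigidityVsSphere`** — which alone contradicts the summit
(`levelRigidityVsSphere_of_spc4`).  The analogue of §8 for the registered skeleton. -/
theorem not_agkCor6Sufficiency_iff_of_levelLine (hE : LevelDatumExists) (hS : LevelStabilizeOne) :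
    ¬ AgkCor6Sufficiency ↔ (AgkHypothesis ∧ ¬ LevelRigidityVsSphere) := by
  rw [not_agkCor6Sufficiency_iff]
  constructor
  · rintro ⟨hX, hns⟩
    exact ⟨hX, fun hLR => hns (nonemptyDiffeomorphSphere_of_levelLine hE hS hLR hX)⟩
  · rintro ⟨hX, hn⟩
    exact ⟨hX, fun hs => hn (levelRigidityVsSphere_of_spc4 hs)⟩

end LevelLine

/-! ## 12. Targets II — sibling line `lp-by-sphere-system-surgery`: the lever is LP in costume -/

section SphereSystem

open Set Function
open scoped Manifold ContDiff Topology

/-- Verbatim copy of the sibling skeleton's lever statement `FillingUniqueness`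
(Meier–Scott 2025, Thm 4.1(2) with `G = 1`). -/
def FillingUniqueness : Prop :=
  ∀ (V V' : Type) [TopologicalSpace V] [T2Space V] [SecondCountableTopology V] [CompactSpace V]
    [ConnectedSpace V] [ChartedSpace (EuclideanHalfSpace 4) V] [IsManifold (𝓡∂ 4) ∞ V]
    [TopologicalSpace V'] [T2Space V'] [SecondCountableTopology V'] [CompactSpace V']
    [ConnectedSpace V'] [ChartedSpace (EuclideanHalfSpace 4) V'] [IsManifold (𝓡∂ 4) ∞ V']
    (_ : IsHandlebodyOfIndexLE 3 1 V) (_ : IsHandlebodyOfIndexLE 3 1 V')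
    (_ : IsOrientable (𝓡∂ 4) V) (_ : IsOrientable (𝓡∂ 4) V')
    (b : BoundaryData (𝓡∂ 4) V (𝓡 3)) (b' : BoundaryData (𝓡∂ 4) V' (𝓡 3))
    (ψ : b.carrier ≃ₘ⟮𝓡 3, 𝓡 3⟯ b'.carrier),
    ∃ Ψ : V ≃ₘ⟮𝓡∂ 4, 𝓡∂ 4⟯ V', ⇑Ψ ∘ b.incl = b'.incl ∘ ⇑ψ

/-- The skeleton's direction: filling uniqueness contains Laudenbach–Poénaru (`V' := V`). -/
theorem lp_of_fillingUniqueness (h : FillingUniqueness) : exists_diffeomorph_comp_incl_eq.{0} :=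
  fun V _ _ _ _ _ _ _ hV ho b φ => h V V hV hV ho ho b b φ

/-- **The converse: Laudenbach–Poénaru already gives filling uniqueness**, through the tree's
PROVED classification of compact connected orientable `4`-dimensional `1`-handlebodies by their
boundary (`nonempty_diffeomorph_of_isHandlebodyOfIndexLE_one_of_boundary_homeomorph`: NORM +
genus count + UNIQ₄, all discharged) and boundary transport (`BoundaryData.restrictDiffeomorph`).
-/
theorem fillingUniqueness_of_lp (hLP : exists_diffeomorph_comp_incl_eq.{0}) : FillingUniqueness := by
  intro V V' _ _ _ _ _ _ _ _ _ _ _ _ _ _ hV hV' ho ho' b b' ψ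
  obtain ⟨Ψ₀⟩ := nonempty_diffeomorph_of_isHandlebodyOfIndexLE_one_of_boundary_homeomorph V V'
    hV hV' ho ho' b b' ψ.toHomeomorph
  obtain ⟨Φ, hΦ⟩ := hLP V hV ho b (ψ.trans (b.restrictDiffeomorph b' Ψ₀).symm)
  refine ⟨Φ.trans Ψ₀, funext fun z => ?_⟩
  have h1 : Φ (b.incl z) = b.incl ((ψ.trans (b.restrictDiffeomorph b' Ψ₀).symm) z) :=
    congrFun hΦ z
  rw [Diffeomorph.coe_trans, comp_apply, comp_apply, h1,
    ← BoundaryData.incl_restrictDiffeomorph (b₂ := b') Ψ₀]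
  simp only [Diffeomorph.coe_trans, comp_apply, Diffeomorph.apply_symm_apply]

/-- **The lever `FillingUniqueness` is EQUIVALENT to the tree's Laudenbach–Poénaru fact**: the
line changes the PROOF of LP (Meier–Scott's sphere-system surgery instead of Laudenbach 1973),
not the statement to be proved. -/
theorem fillingUniqueness_iff_lp : FillingUniqueness ↔ exists_diffeomorph_comp_incl_eq.{0} :=
  ⟨lp_of_fillingUniqueness, fillingUniqueness_of_lp⟩

end SphereSystem


/-! ## 13. Cycle 4 (gen-4 seat): stabilisation remembers the triple; the re-marking automorphism
is load-bearing; and the hidden Nielsen hypothesis of stub (S) is NOT load-bearing for the line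

### 13.1 The retraction `S_{g+3} ↠ S_g`, injectivity of `stabilize`, refuted strengthening III -/

section Retract

open RelatorAut

variable {g : ℕ}

/-- The surface relator dies in `S_g`. -/
theorem mk_surfaceRelator (g : ℕ) :
    (PresentedGroup.mk ({surfaceRelator g} : Set (FreeGroup (surfaceGen g))) (surfaceRelator g) :
      SurfaceGroup g) = 1 :=
  (PresentedGroup.mk_eq_one_iff).2 (subset_normalClosure (Set.mem_singleton _))

/-- **The retraction `ρ : S_{g+3} ↠ S_g` killing the three new handles** (`aᵢ ↦ aᵢ`, `bᵢ ↦ bᵢ`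
for `i < g`, `a_{g+j}, b_{g+j} ↦ 1`), well defined since `r_{g+3} = ι(r_g) · σ(r_3) ↦ 1 · 1`
(geometrically: collapse the summand `Σ₃` of `F # Σ₃`). -/
noncomputable def stabRetract (g : ℕ) : SurfaceGroup (g + 3) →* SurfaceGroup g :=
  presentedLift
    (freeExtend (PresentedGroup.mk ({surfaceRelator g} : Set (FreeGroup (surfaceGen g))))
      (1 : FreeGroup (surfaceGen 3) →* SurfaceGroup g))
    (by
      intro r hr
      rw [Set.mem_singleton_iff] at hr
      subst hr
      rw [surfaceRelator_add_three, map_mul, genIncl_eq_genInclAdd, genShift_eq_genShiftAdd,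
        ← MonoidHom.comp_apply, freeExtend_comp_genInclAdd, ← MonoidHom.comp_apply,
        freeExtend_comp_genShiftAdd, MonoidHom.one_apply, mul_one, mk_surfaceRelator])

/-- `ρ` is the identity on the first `g` handles. -/
@[simp] theorem stabRetract_mk_genIncl (x : FreeGroup (surfaceGen g)) :
    stabRetract g (PresentedGroup.mk _ (genIncl g x)) = PresentedGroup.mk _ x := by
  rw [stabRetract, presentedLift_mk, genIncl_eq_genInclAdd, ← MonoidHom.comp_apply,
    freeExtend_comp_genInclAdd]

/-- `ρ` kills the last three handles. -/
@[simp] theorem stabRetract_mk_genShift (y : FreeGroup (surfaceGen 3)) :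
    stabRetract g (PresentedGroup.mk _ (genShift g y)) = 1 := by
  rw [stabRetract, presentedLift_mk, genShift_eq_genShiftAdd, ← MonoidHom.comp_apply,
    freeExtend_comp_genShiftAdd, MonoidHom.one_apply]

/-- `ρ` is surjective. -/
theorem stabRetract_surjective : Function.Surjective (stabRetract g) := fun x => by
  obtain ⟨x, rfl⟩ := PresentedGroup.mk_surjective _ x
  exact ⟨_, stabRetract_mk_genIncl x⟩

/-- The image under `ρ` of the generating set of a stabilised kernel sits between `N` and
`N ∪ {1}`. -/
theorem image_stabRetract_stabSet (N : Subgroup (SurfaceGroup g)) (S' : Set (SurfaceGroup 3)) :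
    stabRetract g '' stabSet (N : Set (SurfaceGroup g)) S' ⊆ (N : Set (SurfaceGroup g)) ∧
      (N : Set (SurfaceGroup g)) ⊆ stabRetract g '' stabSet (N : Set (SurfaceGroup g)) S' := by
  constructor
  · rintro _ ⟨_, (⟨x, hx, rfl⟩ | ⟨y, -, rfl⟩), rfl⟩
    · rw [Function.comp_apply, stabRetract_mk_genIncl]
      exact hx
    · rw [Function.comp_apply, stabRetract_mk_genShift]
      exact one_mem N
  · intro z hz
    obtain ⟨x, rfl⟩ := PresentedGroup.mk_surjective _ z
    exact ⟨_, Or.inl ⟨x, hz, rfl⟩, stabRetract_mk_genIncl x⟩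

/-- **Stabilisation remembers the triple: `ρ (stabilize K i) = K i`** for normal `K i`
(stabilisation = slot-wise free product with the `S⁴` kernels, and `ρ` kills the second factor). -/
theorem map_stabRetract_stabilize (K : TrisectionKernels g) (i : Fin 3) [(K i).Normal] :
    (K.stabilize i).map (stabRetract g) = K i := by
  rw [TrisectionKernels.stabilize_apply, map_normalClosure _ _ stabRetract_surjective]
  obtain ⟨h₁, h₂⟩ := image_stabRetract_stabSet (K i) (s4Kernels i : Set (SurfaceGroup 3))
  apply le_antisymm
  · exact normalClosure_le_normal h₁
  · exact fun z hz => subset_normalClosure (h₂ hz)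

/-- **`stabilize` is injective on triples of normal subgroups** (in particular on group
trisections of any group): `K # K_{S⁴,3} = K' # K_{S⁴,3} ⇒ K = K'`. -/
theorem stabilize_injective {K K' : TrisectionKernels g} (hK : ∀ i, (K i).Normal)
    (hK' : ∀ i, (K' i).Normal) (h : K.stabilize = K'.stabilize) : K = K' := by
  funext i
  haveI := hK i
  haveI := hK' i
  rw [← map_stabRetract_stabilize K i, ← map_stabRetract_stabilize K' i, h]

/-- The slots of a stabilised triple are normal. -/
instance stabilize_normal (K : TrisectionKernels g) (i : Fin 3) : (K.stabilize i).Normal := by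
  rw [TrisectionKernels.stabilize_apply]
  infer_instance

/-- The slots of an iterated stabilisation of a triple of normal subgroups are normal. -/
theorem stabilizeIter_normal (K : TrisectionKernels g) (hK : ∀ i, (K i).Normal) :
    ∀ (n : ℕ) (i : Fin 3), (K.stabilizeIter n i).Normal
  | 0 => hK
  | n + 1 => fun i => stabilize_normal (K.stabilizeIter n) i

/-- The iterated retraction `ρⁿ : S_{g+3n} ↠ S_g`. -/
noncomputable def stabRetractIter (g : ℕ) : (n : ℕ) → (SurfaceGroup (g + 3 * n) →* SurfaceGroup g)
  | 0 => MonoidHom.id _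
  | n + 1 => (stabRetractIter g n).comp (stabRetract (g + 3 * n))

/-- **`ρⁿ (stabilizeIter K n i) = K i`**: every stabilisation remembers the original triple. -/
theorem map_stabRetractIter_stabilizeIter (K : TrisectionKernels g) (hK : ∀ i, (K i).Normal) :
    ∀ (n : ℕ) (i : Fin 3), (K.stabilizeIter n i).map (stabRetractIter g n) = K i
  | 0 => fun i => Subgroup.map_id _
  | n + 1 => fun i => by
    haveI := stabilizeIter_normal K hK n i
    show ((K.stabilizeIter n).stabilize i).map ((stabRetractIter g n).comp (stabRetract (g + 3 * n))) = K i
    rw [← Subgroup.map_map, map_stabRetract_stabilize, map_stabRetractIter_stabilizeIter K hK n i]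

/-- **Iterated stabilisation is injective** on triples of normal subgroups. -/
theorem eq_of_stabilizeIter_eq {K K' : TrisectionKernels g} (hK : ∀ i, (K i).Normal)
    (hK' : ∀ i, (K' i).Normal) (n : ℕ) (h : K.stabilizeIter n = K'.stabilizeIter n) : K = K' := by
  funext i
  rw [← map_stabRetractIter_stabilizeIter K hK n i, ← map_stabRetractIter_stabilizeIter K' hK' n i, h]

/-- AGK's condition with `Iso` replaced by EQUALITY of kernel triples ("stably standard ON THE
NOSE", no re-marking automorphism of `S_g`): a natural strengthening of `X`. -/
def AgkHypothesisNose : Prop :=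
  ∀ (k : ℕ) (K : TrisectionKernels (3 * k)), IsGroupTrisection (3 * k) k (PUnit : Type) K →
    ∃ (n m : ℕ) (h : 3 + 3 * m = 3 * k + 3 * n), K.stabilizeIter n = (s4Kernels.stabilizeIter m).cast h

/-- The standard genus-`3` triple with its slots cycled, `(N₂, N₀, N₁)`: the image of `s4Kernels`
under the relator-fixing cyclic handle shift `cyc` of `StandardTrisectionSlotSymmetry.lean`
(`map_cyc_s4Kernels`; geometrically, the genus-`3` trisection of `S⁴` with its sectors relabelled). -/
def cycKernels : TrisectionKernels 3 := fun i => s4Kernels (cycPerm i)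

/-- It is a `(3,1)` group trisection of `{1}` (slot permutation invariance). -/
theorem cycKernels_isGroupTrisection : IsGroupTrisection 3 1 (PUnit : Type) cycKernels :=
  s4Kernels_isGroupTrisection_holds.comp_perm cycPerm

/-- `s4Kernels ≅ cycKernels` by `cyc`. -/
theorem iso_s4Kernels_cycKernels : TrisectionKernels.Iso s4Kernels cycKernels :=
  ⟨cyc.toMulEquiv, map_cyc_s4Kernels⟩

/-- … hence `cycKernels` is stably trivial with no stabilisation at all (`n = m = 0`). -/
theorem cycKernels_isStablyTrivial : cycKernels.IsStablyTrivial :=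
  ⟨0, 0, rfl, iso_s4Kernels_cycKernels.symm⟩

/-- `a₀ ∉ N₂ = ⟪b₀, a₁, a₂⟫` (it survives in `S_3 / N₂ ≅ F⟨a₀, b₁, b₂⟩`). -/
theorem a_zero_not_mem_s4Kernels_two : SurfaceGroup.a 0 ∉ s4Kernels 2 := by
  intro h
  have hker := s4Kernels_le_ker (s4Gens 2) (s4Gens_hits 2) 2 (fun x hx => hx) h
  rw [MonoidHom.mem_ker, SurfaceGroup.a, eraseHom_of, eraseGen_of_not_mem (by decide)] at hker
  exact FreeGroup.of_ne_one _ hker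

/-- … so the cycled triple differs from the standard one (in slot `0`: `N₂ ≠ N₀`). -/
theorem cycKernels_ne_s4Kernels : cycKernels ≠ s4Kernels := by
  intro h
  have h0 : s4Kernels 2 = s4Kernels 0 := by
    have := congrFun h 0
    rwa [cycKernels, cycPerm_apply.1] at this
  have ha : SurfaceGroup.a 0 ∈ s4Kernels 0 := subset_normalClosure (by simp)
  rw [← h0] at ha
  exact a_zero_not_mem_s4Kernels_two ha

/-- **Refuted strengthening III: the re-marking automorphism in `IsStablyTrivial` is
load-bearing.**  "Every `(3k,k)` group trisection of `{1}` becomes LITERALLY a standard triple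
after stabilising" (`AgkHypothesisNose`) is false already at `k = 1`: the standard genus-`3`
triple with cycled slots is a `(3,1)` group trisection of `{1}`, isomorphic to `s4Kernels` — so
stably trivial with `n = m = 0` — but NO stabilisation of it EQUALS a standard triple, since the
retraction `ρⁿ : S_{3+3n} ↠ S_3` recovers the original slots from any stabilisation.  So `X`
cannot be consumed or supplied "on the nose": the change of marking (an element of `Aut S_g`, on
the geometric side Dehn–Nielsen–Baer) is essential, and with it the question of pushing `Iso`
through `stabilize` (§10, §11.4, §13.2). -/
theorem not_agkHypothesisNose : ¬ AgkHypothesisNose := by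
  intro h
  obtain ⟨n, m, hnm, heq⟩ := h 1 cycKernels cycKernels_isGroupTrisection
  obtain rfl : n = m := by omega
  have heq' : cycKernels.stabilizeIter n = s4Kernels.stabilizeIter n := heq
  exact cycKernels_ne_s4Kernels (eq_of_stabilizeIter_eq (fun i => cycKernels_isGroupTrisection.normal i)
    (fun i => s4Kernels_isGroupTrisection_holds.normal i) n heq')

/-- Positive by-product for provers: on group trisections, an EQUALITY of `n`-th stabilisations
is an equality of the triples, so every invariant of `K` is an invariant of `K.stabilizeIter n`
read through `ρⁿ` (e.g. for distinguishing stabilised triples up to automorphisms preserving the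
splitting `S_{g+3n} = S_g ∗_ℤ S_{3n}`). -/
theorem stabilizeIter_injective_of_isGroupTrisection {k k' : ℕ} {G G' : Type} [Group G] [Group G']
    {K K' : TrisectionKernels g} (hK : IsGroupTrisection g k G K) (hK' : IsGroupTrisection g k' G' K')
    (n : ℕ) (h : K.stabilizeIter n = K'.stabilizeIter n) : K = K' :=
  eq_of_stabilizeIter_eq hK.normal hK'.normal n h

end Retract

/-! ### 13.2 The hidden Nielsen hypothesis of stub (S) is NOT load-bearing for the line:
an `X`-once composition from N₁-free weakenings of (S) plus a genus-`0` level datum of `S⁴`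

Cycle 3 (§11.4) and the drefute seat showed that the registered stub (S) `LevelStabilizeOne`
(`∃ d' ∀ markings`) CONTAINS N₁ = `Aut S_g`-invariance of `stabilizeOne` on realised triples
(= Nielsen lifting, the §10 tree gap), and the drefute note argued that the skeleton's composition
"cannot dodge N₁ in this architecture" because the `S⁴` side is identified with the standard triple
only ABSTRACTLY (by `X`) and must then be stabilised further.  The theorems below make the escape
precise and kernel-checked: replace (S) by its two N₁-free weakenings
(Sₓ) `LevelStabilizeOneExists` — one-slot stabilisation changes the TYPE, kernels not tracked
(used only for balancing) — and (S_nose) `LevelRoundsNose` — for ONE marking of a balanced datum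
(the geometric, disc-based one; Gay–Kirby Lemma 10 / AGK Thm. 5 computed on the nose, iterated
with the extended geometric markings), full rounds realise `stabilizeIter n` LITERALLY — and add
(Z₀) `SphereLevelDatumZero`, a level datum of type `(0; 0,0,0)` on the round `S⁴` (the height
function: the E₀ pipeline `BiCollar.shrunk` / `TriData.ofLevels` / `exists_isGKTrisection_of_params`
run on `𝕊⁴ ⊃ 𝕊³ ⊃ 𝕊²`; size L, no new theory).  Then `X` is applied ONCE (to the geometric
marking of `M`'s balanced datum), the `S⁴` side is standard ON THE NOSE at EVERY level
(`trivialKernels.stabilizeIter (m+1) = s4Kernels.stabilizeIter m`, `TrisectionKernels 0` being a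
subsingleton no marking of the genus-`0` datum matters), the level `m` dictated by `X` is met
exactly, and no `Iso` is ever pushed through a stabilisation
(`nonemptyDiffeomorphSphere_of_levelLine_nose`).  Both weakenings follow from the registered (S)
(`levelStabilizeOneExists_of_levelStabilizeOne`, `levelRoundsNose_of_levelStabilizeOne`), so the
trade is exactly **N₁ (Nielsen 1927, L–XL new algebra) ↔ (Z₀) (one explicit genus-`0` level
datum)**; DNB/HKE/LP/(R1)/(R2) are untouched and still enter only through `LevelRigidityVsSphere`.
By §13.1 the re-marking automorphism itself cannot be removed from `X`; what is removed is the
need to transport it through stabilisations. -/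

section NoseLine

open Set ContinuousMap LevelSetKirbyTriple
open scoped Manifold ContDiff Topology

local notation "𝕊⁴" => (Metric.sphere (0 : EuclideanSpace ℝ (Fin 5)) 1)

/-- **(Sₓ) one-slot stabilisation, existence only**: a level datum of type `(g; κ)` yields one of
type `(g + 1; κ + eᵢ)` (a `(1,2)`-birth / Heegaard stabilisation of the level / `(2,3)`-birth);
kernels are not mentioned.  N₁-free weakening of (S), used only for balancing. -/
def LevelStabilizeOneExists : Prop :=
  ∀ (M : Type) [TopologicalSpace M] [T2Space M] [SecondCountableTopology M] [CompactSpace M]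
    [ChartedSpace (EuclideanSpace ℝ (Fin 4)) M] [IsManifold (𝓡 4) ∞ M] [ConnectedSpace M]
    (_ : SmoothOrientation (𝓡 4) M) (g : ℕ) (κ : Fin 3 → ℕ) (_ : LevelDatum M g κ) (i : Fin 3),
    Nonempty (LevelDatum M (g + 1) (Function.update κ i (κ i + 1)))

/-- **(S_nose) full rounds on the nose for ONE marking**: a balanced level datum carries SOME
based marking `(x₀, μ₀)` of its central surface (on paper: a geometric, disc-based one) such that
for every `n` some level datum of type `(g + 3n; k + n)` with some marking has Kirby triple
LITERALLY `(d.kernels x₀ μ₀).stabilizeIter n`.  N₁-free on paper (Gay–Kirby Lemma 10 / AGK Thm. 5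
for geometric markings, iterated with the extended geometric markings; no arbitrary marking is
ever served). -/
def LevelRoundsNose : Prop :=
  ∀ (M : Type) [TopologicalSpace M] [T2Space M] [SecondCountableTopology M] [CompactSpace M]
    [ChartedSpace (EuclideanSpace ℝ (Fin 4)) M] [IsManifold (𝓡 4) ∞ M] [ConnectedSpace M]
    (_ : SmoothOrientation (𝓡 4) M) (g k : ℕ) (d : LevelDatum M g (fun _ => k)),
    ∃ (x₀ : centralSurface d.T.sectors)
      (μ₀ : SurfaceGroup g ≃* FundamentalGroup (centralSurface d.T.sectors) x₀),
      ∀ n : ℕ, ∃ (d' : LevelDatum M (g + 3 * n) (fun _ => k + n)) (x' : centralSurface d'.T.sectors)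
        (μ' : SurfaceGroup (g + 3 * n) ≃* FundamentalGroup (centralSurface d'.T.sectors) x'),
        d'.kernels x' μ' = (d.kernels x₀ μ₀).stabilizeIter n

/-- **(Z₀) the round `S⁴` carries a level datum of type `(0; 0, 0, 0)`** (height function, equator
`S³`, Heegaard sphere `S²`: Gay–Kirby's genus-`0` trisection of `S⁴` read with its Morse data). -/
def SphereLevelDatumZero : Prop := Nonempty (LevelDatum 𝕊⁴ 0 (fun _ => 0))

/-- (S) ⟹ (Sₓ). -/
theorem levelStabilizeOneExists_of_levelStabilizeOne (hS : LevelStabilizeOne) :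
    LevelStabilizeOneExists := by
  intro M _ _ _ _ _ _ _ o g κ d i
  obtain ⟨d', -⟩ := hS M o g κ d i
  exact ⟨d'⟩

/-- (S) ⟹ (S_nose) (with ANY marking as the distinguished one; a marking exists by the discharged
leaf (g′)). So (Sₓ) ∧ (S_nose) is a genuine weakening of the registered stub. -/
theorem levelRoundsNose_of_levelStabilizeOne (hS : LevelStabilizeOne) : LevelRoundsNose := by
  intro M _ _ _ _ _ _ _ o g k d
  obtain ⟨x₀, ⟨μ₀⟩⟩ :=
    exists_marking_centralSurface_of_gkTrisection_holds M o g k d.T.sectors d.isGKTrisection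
  exact ⟨x₀, μ₀, fun n => exists_levelDatum_stabilizeIter hS o d x₀ μ₀ n⟩

/-- Balanced level data from (E₀) and (Sₓ) (kernels not tracked: `exists_balanced_of_stabilize`). -/
theorem exists_levelDatum_balanced_of_exists (hE : LevelDatumExists) (hSx : LevelStabilizeOneExists)
    {M : Type} [TopologicalSpace M] [T2Space M] [SecondCountableTopology M] [CompactSpace M]
    [ChartedSpace (EuclideanSpace ℝ (Fin 4)) M] [IsManifold (𝓡 4) ∞ M] [ConnectedSpace M]
    (o : SmoothOrientation (𝓡 4) M) :
    ∃ g k : ℕ, Nonempty (LevelDatum M g (fun _ => k)) := by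
  obtain ⟨g, κ, ⟨d⟩⟩ := hE M
  have hstab : ∀ (g : ℕ) (κ : Fin 3 → ℕ) (i : Fin 3), Nonempty (LevelDatum M g κ) →
      Nonempty (LevelDatum M (g + 1) (Function.update κ i (κ i + 1))) := by
    rintro g κ i ⟨d⟩
    exact hSx M o g κ d i
  obtain ⟨g', k', -, h⟩ :=
    TrisectionBalancing.exists_balanced_of_stabilize (P := fun g κ => Nonempty (LevelDatum M g κ))
      hstab ⟨d⟩
  exact ⟨g', k', h⟩

/-- **The genus-`0` tower is standard on the nose at every level**:
`trivialKernels.stabilizeIter (m + 1) = s4Kernels.stabilizeIter m` (up to the transport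
`3 + 3m = 0 + 3(m+1)`), by `trivialKernels.stabilize = s4Kernels` (§4) and induction. -/
theorem trivialKernels_stabilizeIter_succ : ∀ m : ℕ,
    trivialKernels.stabilizeIter (m + 1) =
      (s4Kernels.stabilizeIter m).cast (by omega : 3 + 3 * m = 0 + 3 * (m + 1))
  | 0 => by
    show trivialKernels.stabilize = _
    rw [trivialKernels_stabilize]
    rfl
  | m + 1 => by
    show (trivialKernels.stabilizeIter (m + 1)).stabilize = _
    rw [trivialKernels_stabilizeIter_succ m, stabilize_cast]
    rfl

/-- **The `X`-once, N₁-free composition.**  From (E₀), (Sₓ), (S_nose), (Z₀), the load-bearing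
instance `LevelRigidityVsSphere` of (R1, R2) and AGK's condition `X`, the summit: balance a level
datum of the homotopy sphere `M` (type `(3k; k)` by `χ = 2`), take the distinguished marking
`(x₀, μ₀)` of (S_nose) and apply `X` ONCE to its Kirby triple `K₀` — `Iso (K₀.stabilizeIter n)
(std_m)` with `k + n = 1 + m` forced (§10) —; realise `K₀.stabilizeIter n` on the nose by the tower
of (S_nose); on the `S⁴` side stabilise the genus-`0` datum of (Z₀) `m + 1` rounds, which is
`std_m` ON THE NOSE whatever markings the tower uses (`trivialKernels_stabilizeIter_succ`,
`eq_trivialKernels`); the two data have the same type `(3 + 3m; m + 1)` and `Iso` Kirby triples, and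
`LevelRigidityVsSphere` gives `M ≅ S⁴`.  No `Iso` is pushed through any stabilisation, so neither
Nielsen lifting nor (d′) is used. -/
theorem nonemptyDiffeomorphSphere_of_levelLine_nose (hE : LevelDatumExists)
    (hSx : LevelStabilizeOneExists) (hR : LevelRoundsNose) (h0 : SphereLevelDatumZero)
    (hLR : LevelRigidityVsSphere) (hX : AgkHypothesis)
    (M : Type) [TopologicalSpace M] [T2Space M] [SecondCountableTopology M] :
    HomotopyEquiv.NonemptyDiffeomorphSphere M 4 := by
  intro _ _ e
  haveI : CompactSpace M := compactSpace_of_homotopyEquiv_sphere_four_holds M e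
  obtain ⟨o⟩ := isOrientable_of_homotopyEquiv_sphere_four_holds M e
  haveI : SimplyConnectedSpace 𝕊⁴ := simplyConnectedSpace_sphere_four_holds
  haveI : SimplyConnectedSpace M := e.simplyConnectedSpace
  obtain ⟨o'⟩ := isOrientable_sphere_holds 4
  -- `M` side: a balanced datum, ONE marking with its tower, `X` applied once
  obtain ⟨G, k, ⟨d⟩⟩ := exists_levelDatum_balanced_of_exists hE hSx o
  obtain rfl : G = 3 * k :=
    gkTrisection_genus_eq_sum_of_homotopyEquiv_sphere_holds.balanced M o d.isGKTrisection e
  obtain ⟨x₀, μ₀, tower⟩ := hR M o (3 * k) k d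
  have hK : IsGroupTrisection (3 * k) k (PUnit : Type) (d.kernels x₀ μ₀) :=
    (isGroupTrisection_groupGKTrisectionOf_holds M o (3 * k) k d.T.sectors d.isGKTrisection
      x₀ μ₀).punit_of_subsingleton
  obtain ⟨n, m, hnm, iso⟩ := hX k _ hK
  have hkn : k + n = 1 + m := eq_of_isStablyTrivial_witness hK hnm iso
  obtain ⟨dₙ, xₙ, μₙ, hdₙ⟩ := tower n
  -- `S⁴` side: the genus-`0` datum stabilised `m + 1` rounds is standard ON THE NOSE
  obtain ⟨e₀⟩ := h0
  obtain ⟨y₀, ν₀, stower⟩ := hR 𝕊⁴ o' 0 0 e₀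
  obtain ⟨eₘ, yₘ, νₘ, heₘ⟩ := stower (m + 1)
  have hg : 3 * k + 3 * n = 0 + 3 * (m + 1) := by omega
  have hκ : (fun _ : Fin 3 => k + n) = fun _ => 0 + (m + 1) := by
    funext
    omega
  refine nonempty_diffeomorph_sphere_of_iso_cast_level hLR o e o' hg hκ dₙ eₘ xₙ μₙ yₘ νₘ ?_
  rw [hdₙ, heₘ, eq_trivialKernels (e₀.kernels y₀ ν₀), trivialKernels_stabilizeIter_succ m]
  have hiso := (iso_cast_iff hg _ _).2 iso
  rw [cast_cast] at hiso
  exact hiso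

/-- **Granted (E₀), (Sₓ), (S_nose), (Z₀) — all N₁-free —, a disproof of the crux along this line is
again exactly `X` AND a failure of `LevelRigidityVsSphere`**, which alone contradicts the summit
(`levelRigidityVsSphere_of_spc4`): the analogue of §11.3 without the hidden Nielsen hypothesis. -/
theorem not_agkCor6Sufficiency_iff_of_noseLine (hE : LevelDatumExists)
    (hSx : LevelStabilizeOneExists) (hR : LevelRoundsNose) (h0 : SphereLevelDatumZero) :
    ¬ AgkCor6Sufficiency ↔ (AgkHypothesis ∧ ¬ LevelRigidityVsSphere) := by
  rw [not_agkCor6Sufficiency_iff]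
  constructor
  · rintro ⟨hX, hns⟩
    exact ⟨hX, fun hLR => hns (nonemptyDiffeomorphSphere_of_levelLine_nose hE hSx hR h0 hLR hX)⟩
  · rintro ⟨hX, hn⟩
    exact ⟨hX, fun hs => hn (levelRigidityVsSphere_of_spc4 hs)⟩

/-- The registered stubs feed the new composition: with (S) as registered, only (Z₀) is new. -/
theorem nonemptyDiffeomorphSphere_of_levelLine_zero (hE : LevelDatumExists) (hS : LevelStabilizeOne)
    (h0 : SphereLevelDatumZero) (hLR : LevelRigidityVsSphere) (hX : AgkHypothesis)
    (M : Type) [TopologicalSpace M] [T2Space M] [SecondCountableTopology M] :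
    HomotopyEquiv.NonemptyDiffeomorphSphere M 4 :=
  nonemptyDiffeomorphSphere_of_levelLine_nose hE (levelStabilizeOneExists_of_levelStabilizeOne hS)
    (levelRoundsNose_of_levelStabilizeOne hS) h0 hLR hX M

end NoseLine

end Summit.SmoothPoincare4.SmoothPoincare4.Cruxes.AgkCor6Sufficiency.Disproof
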